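import Literature.MathematicalPhysics.QuantumFieldTheory.Balaban1983to89.T4DirectionChart

/-!
# T4RelativeLadder (v5 = v4 + DOCFIX) — relative non-abelian Stokes on a ladder: the transverse defect of a pair of configurations in
RELATIVE axial gauge is the ℓ¹-sum of their relative plaquette deviations (cell `pub-balaban`, T4-DAG §6 spine estimate
NE1′ = O3b/H2, prover seat P1, row `T4-O3.E-NE1′-P1-LADDER*` carved from GAPS G-ne1p1-1 = located obligation O-G1′ of
record `t4/T4-EST-NE1p-P1.md` §4 (O2); companion of `T4BirthChartTransport`)

HONEST FRAMING (cell `pub-balaban`, T4-DAG PAGE 1).  The cell's T4 target is the existence AND uniqueness of the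
continuum limit of Bałaban's unit-scale averaged loop expectations on a FINITE four-torus at rung (B)+1 — CONDITIONAL on
BetaPertH and on (B)/(B^μ) wherever a consumer uses them (NONE is used in this file: elementary normed-ring algebra on
abstract data); NOT infinite volume, NOT the mass gap, NOT Clay.  Nothing about Bałaban's renormalization-group objects
is asserted.

WHAT THIS FILE IS FOR.  `T4BirthChartTransport.transport_of_birthChart` bounds the response of a gauge-invariant
carried term by `(4A/r)·δ`, `δ` = the window norm of ANY direction gauge-equivalent to the actual one (hypothesis shape
`T4BirthChartTransport.RelGauge`); the rate `φ = L⁻²` per order needs the TRANSVERSE representative, whose size must be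
controlled by the CURVATURE change between the two configurations times a constant LINEAR in the diameter of the region
(input (I4) = O-G1′, "relative covariant axial gauge, non-abelian, C_P(R) = O(R)").  This file proves the abstract,
sup-norm half of (I4) in a normed ring `R` with "unitary-like" units (‖u‖ ≤ 1 and ‖u⁻¹‖ ≤ 1 — the G-valued bond
variables; for them conjugation is an ISOMETRY on `· − 1`, §1):
(1) RELATIVE TREE TRANSPORT (§2): the gauge transformation `u` matching configuration 1 to configuration 0 along a path
    of tree bonds (`relTransport`: `u₀ = 1`, `u_{x+1} = h₀(x)⁻¹·u_x·h₁(x)`, so that `u_x·h₁(x)·u_{x+1}⁻¹ = h₀(x)`,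
    `relTransport_fixes`) satisfies `‖u_n − 1‖ ≤ Σ_{x<n} ‖h₁(x) − h₀(x)‖` (`norm_relTransport_sub_one_le`) — the
    RELATIVE form of the printed chain count "|V₀(Γ_{c,x}) − 1| ≦ Σ_{b⊂Γ_{c,x}} |V₀,b − 1|" ([Balaban1985Averaging] (44)–(47)
    pp. 24–25, kernel `T4AxialChain.norm_prod_sub_one_le_sum`).
(2) LADDER RECURSION (§3): on a ladder whose horizontal bonds (bottom `hb`, top `ht`) are SHARED by the two
    configurations (relative axial gauge along the two teeth) and whose vertical bonds are `v₀`, `v₁`, the plaquette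
    holonomies `P_c(m) = hb(m)·v_c(m+1)·ht(m)⁻¹·v_c(m)⁻¹` and the transverse defects `W(m) = v₁(m)·v₀(m)⁻¹` satisfy the
    IDENTITY `W(m+1) = hb(m)⁻¹·(P₁(m)·W(m)·P₀(m)⁻¹)·hb(m)` (`defect_succ`), hence
    `‖W(m+1) − 1‖ ≤ ‖W(m) − 1‖ + ‖P₁(m) − P₀(m)‖` and, if the first rung is a tree bond (`v₁ 0 = v₀ 0`),
    `‖W(n) − 1‖ ≤ Σ_{m<n} ‖P₁(m) − P₀(m)‖` (`norm_defect_sub_one_le_sum`): the transverse defect is the ℓ¹-sum of the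
    relative plaquette deviations along the ladder — constant = ladder length, LINEAR (`norm_defect_sub_one_le_mul`).
(3) THE COMMUTATOR CROSS TERM (§4): the relative plaquette deviation AFTER gauge fixing, `‖u·P₁·u⁻¹ − P₀‖`, exceeds the
    raw one by at most `2‖u − 1‖·‖P₀ − 1‖` (`norm_conj_sub_le`) — second-order small (relative transport × base
    curvature); assembled count `‖W(n) − 1‖ ≤ n·(p + 2·t·q)` (`norm_defect_le_linear`).
(4) DIFFERENCES (§6, v3): along the ladder the difference of consecutive defects is LOCAL
    (`norm_defect_succ_sub_defect_le`); ACROSS two adjacent ladders of the comb the COVARIANT difference `covDiff`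
    (upper defect transported down along the base vertical bond) obeys the one-step recursion `norm_covDiff_succ_le`
    with source = the covariant difference of the relative plaquette deviations `covDev` (the TYPED FORM of the located
    input (O2c) "incl. gradients") + base-curvature data × first-order terms, from the two-ladder identity
    `covariant_succ`; summed along the tooth (Grönwall): `norm_covDiff_le`,
    `‖D(x,y)‖ ≤ (1+p)^x·x·(g + (2x+1)pq′ + 2(x+1)pq)`.
(5) SCALING OF BLOCK-SUMMED DIRECTIONS (§7, v4; the abelian 1-D toy of input (O2d), raised by XREAD C-pv20-33 O2):
    a fine 1-form with values `≤ a` and consecutive differences `≤ s`, block-summed over `N` fine bonds, has coarse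
    amplitude `≤ N·a` (`norm_blockSum_le`) but coarse difference over a displacement of one block `≤ N²·s`
    (`norm_blockSum_block_shift_sub_le`; exact for a linear form, `blockSum_linear_block_shift`) — the curl of a
    block-summed direction is one factor `N·s/a` below its amplitude: the 2-form scaling `(L^{j}η)²` against the
    printed 1-form amplitude "|B| < O(1)L^{j}η" ([Balaban1987RG1] p. 277) whenever amplitude and unit-scale gradient
    obey the same bound, which is the FORMAT of (3.32) p. 277 "|A|, |∇^ηA|, ‖A‖_{1,β} < 2(α₂ + B₃O(1)Mα₀)" for
    Bałaban's own direction.  Not toy, not claimed: the commutation of the non-abelian averaging `Q` with covariant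
    differences — an UNPRINTED cell hypothesis ([Balaban1985Averaging] (44)–(47) pp. 24–25 print the ONE-STEP
    REGULARITY of the averaged field in a local axial gauge and the chain count quoted in (1), NOT a commutation-with-d
    identity; v5 DOCFIX after `t4/CITED-FACTS-T4.md` v1 §2/§4, t4-lit1) — and the two fine bounds for the cell's
    observable-moved direction.
(6) REBASING / BLOCK PATCHING (§8, v4; the ladder-level form of input (O2b)): the relative gauge re-based at rung `x₁`
    differs from the global one by a transition factor `c_m = B_m⁻¹·u(x₁)·B_m` (`relTransport_rebase`) with CONSTANT
    deviation `‖c_m − 1‖ = ‖u(x₁) − 1‖` (`norm_transition_sub_one_eq`) and SECOND-ORDER variation along the block,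
    `‖c_{m+1} − c_m‖ ≤ 2‖h₀(x₁+m) − 1‖·‖u(x₁) − 1‖` (`norm_transition_succ_sub_le`, from the commutator estimate
    `norm_unit_conj_sub_self_le`), summed `‖c_m − c_0‖ ≤ m·2bT` (`norm_transition_sub_transition_zero_le`): windows
    measured block by block in the block's own relative gauge see only LOCAL sums, and the patching maps are
    rotations that are covariantly almost constant.  Not here: the d-dimensional M-cube geometry of
    [Balaban1985RegularSpaces] Lemma 1 and overlaps of more than two blocks.
(7) SECOND DIFFERENCES ALONG THE LADDER (§9, v4; the first piece of the Hölder part of (O2a)): with the LINEAR ladder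
    map `F_m(X) = hb(m)⁻¹·(P₁(m)·X·P₀(m)⁻¹)·hb(m)` (`ladderMap`, `defect_succ_eq_ladderMap`),
    `Δ²W(m) = [F_{m+1} − F_m](W(m+1)) + [F_m − id](ΔW(m))`; the first bracket is first order in the x-GRADIENTS of
    the data (`norm_ladderMap_sub_ladderMap_le`, via `norm_conj_sub_conj_le` and §6's `norm_triple_sub_triple_le`),
    the second is the local first difference times the smallness of `P₁ − 1`, `P₀ − 1`, `hb − 1`
    (`norm_ladderMap_sub_self_le`); assembled: `norm_defect_second_diff_le` — along a tooth both Δ and Δ² of the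
    transverse defect are LOCAL in the deviation, its gradient and base data.
WHAT STAYS OPEN (record `t4/T4-EST-NE1p-P1.md` §4 (O2), GAPS G-ne1p1-1, G-ne1p1-3): the Hölder quotient of
[Balaban1987RG1] (3.31) p. 276 itself (elementary interpolation from Δ, Δ² along teeth — not formalised) and the
second differences ACROSS teeth (xy, yy: the covariant recursion of §6 one level up — census, kernel deferred); the
d-dimensional block-wise (covariant, M-cube) choice of combs à la [Balaban1985RegularSpaces] Lemma 1 p. 79 beyond the
1-D rebasing of §8; the non-abelian averaging half of (O2d) beyond the abelian toy of §7; and the input that the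
curvature change of the MOVED BACKGROUND is second-order small INCLUDING gradients — printed for Bałaban's own
background response: "(3.37) … |H_j(□₀, τQ(…))|, |∇^ξH_j(□₀, τQ(…))| < B₃²O(1)Mα₀L^{j−1}η" ([Balaban1987RG1] p. 277),
a HYPOTHESIS for the cell's use.  Value = elementary kernel algebra making the LINEAR-in-diameter constant of (I4)
checkable; NOT summit progress.

PRINTED LOCI (verbatim; renders / text layers as in `T4AxialChain` and `T4BirthChartTransport`).
* [Balaban1985Averaging] pp. 24–25: "let us introduce locally the axial gauge with the initial point y" … "V₀ = V^{v₀}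
  satisfies the conditions V₀(Γ_{y,x}) = 1" … "|V₀(Γ_{c,x}) − 1| ≦ Σ_{b⊂Γ_{c,x}} |V₀,b − 1|" (quoted in full in the
  header of `T4AxialChain`, certified there). [cite: Balaban1985Averaging, (44)–(47) pp. 24–25]
* [Balaban1985RegularSpaces] p. 79, Lemma 1: the RELATIVE count "Let V₀, V′V₀ satisfy the condition (1.7) … and let
  (R(V₀)V′)(Γ_{y,x}) = 1 for x ∈ B(y) … Then for α₀, α₁ small the configuration V′ is also small, more precisely we have
  the bound |V′ − 1| < 4d²α₀ + α₁ on Ω₁. (1.25)" (quoted in the header of `T4AxialChain`, certified there).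
  [cite: Balaban1985RegularSpaces, Lemma 1 p. 79]
* [Balaban1987RG1] p. 277 (3.37), quoted above and in `T4BirthChartTransport`. [cite: Balaban1987RG1, (3.37) p. 277]

DICTIONARY WITH THE CHART (v2; nothing of another lineage's file is touched — imports BY NAME only).  The predicate
`UnitaryLike` IS the direction chart's G-valued unit `T4DirectionChart.GUnit` (lineage pv20: `‖u‖ ≤ 1 ∧ ‖u⁻¹‖ ≤ 1`),
kept here as a reducible ABBREVIATION so that every v1 statement stands verbatim and every chart hypothesis
`GUnit u` is accepted as is (`unitaryLike_iff_gUnit : UnitaryLike u ↔ GUnit u` is `Iff.rfl`); the ladder's plaquette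
convention is the chart's `basePlaq U₁ U₂ U₃ U₄ = U₁U₂U₃⁻¹U₄⁻¹` (`plaq_eq_basePlaq`, `rfl`); the cross term is restated
in the chart's `transport u A = u·A·u⁻¹` vocabulary (`norm_transport_sub_le`).  The U(n)/SU(n) suppliers of the
predicate are `T4BackgroundDeviationChart.gUnit_toUnits` / `…_SU` (lineage pv04; named, not imported).  v1 (p184152)
imported `T4AxialChain` only; v2 imports `T4DirectionChart` (which imports `T4AxialChain` transitively).

LABELS. [folklore] = elementary normed-ring algebra on abstract data (every decl below); [cell] = the reading of the
data as bond variables of two lattice configurations (docstrings only, never asserted).  No `sorry`, no new axioms.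
-/

namespace Literature.MathematicalPhysics.QuantumFieldTheory.Balaban1983to89.T4RelativeLadder

open Finset

variable {R : Type*} [NormedRing R]

/-! ## §1  Unitary-like units: conjugation is an isometry on `· − 1` -/

/-- HYPOTHESIS SHAPE — a "unitary-like" unit: `‖u‖ ≤ 1` and `‖u⁻¹‖ ≤ 1` (intended [cell]: a G-valued bond variable,
G ⊂ U(N) compact; NOT the complexified Gᶜ-valued ones, for which conjugation costs `‖u‖‖u⁻¹‖`,
`T4AxialChain.norm_conj_sub_one_le`).  BY DEFINITION the direction chart's `T4DirectionChart.GUnit` (reducible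
abbreviation; `unitaryLike_iff_gUnit`). [folklore] -/
abbrev UnitaryLike (u : Rˣ) : Prop := T4DirectionChart.GUnit u

/-- The dictionary is the identity: `UnitaryLike u ↔ T4DirectionChart.GUnit u`. [folklore] -/
theorem unitaryLike_iff_gUnit (u : Rˣ) : UnitaryLike u ↔ T4DirectionChart.GUnit u := Iff.rfl

/-- Unfolded: `UnitaryLike u ↔ ‖u‖ ≤ 1 ∧ ‖u⁻¹‖ ≤ 1` (the v1 letter). [folklore] -/
theorem unitaryLike_iff (u : Rˣ) : UnitaryLike u ↔ ‖(u : R)‖ ≤ 1 ∧ ‖((u⁻¹ : Rˣ) : R)‖ ≤ 1 := Iff.rfl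

namespace UnitaryLike

/-- (`T4DirectionChart.GUnit.inv` by name.) [folklore] -/
theorem inv {u : Rˣ} (h : UnitaryLike u) : UnitaryLike u⁻¹ := T4DirectionChart.GUnit.inv h

/-- (`T4DirectionChart.GUnit.mul` by name.) [folklore] -/
theorem mul {u v : Rˣ} (hu : UnitaryLike u) (hv : UnitaryLike v) : UnitaryLike (u * v) :=
  T4DirectionChart.GUnit.mul hu hv

/-- [folklore] -/
theorem one [NormOneClass R] : UnitaryLike (1 : Rˣ) := ⟨by simp, by simp⟩

end UnitaryLike

/-- CONJUGATION ISOMETRY: for unitary-like `u`, `‖u·x·u⁻¹ − 1‖ = ‖x − 1‖` (the inequality half is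
`T4AxialChain.norm_conj_sub_one_le_of_norm_le_one`; the other half is the same with `u⁻¹`). [folklore] -/
theorem norm_conj_sub_one_eq {u : Rˣ} (hu : UnitaryLike u) (x : R) : ‖(u : R) * x * ↑u⁻¹ - 1‖ = ‖x - 1‖ := by
  refine le_antisymm (T4AxialChain.norm_conj_sub_one_le_of_norm_le_one u x hu.1 hu.2) ?_
  have h := T4AxialChain.norm_conj_sub_one_le_of_norm_le_one u⁻¹ ((u : R) * x * ↑u⁻¹) hu.2 (by simpa using hu.1)
  have e : ((u⁻¹ : Rˣ) : R) * ((u : R) * x * ↑u⁻¹) * ↑(u⁻¹)⁻¹ = x := by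
    rw [inv_inv, ← mul_assoc, ← mul_assoc, Units.inv_mul, one_mul, mul_assoc, Units.inv_mul, mul_one]
  rwa [e] at h

/-- Right multiplication by a unitary-like unit does not increase `‖· ‖`: `‖x·u‖ ≤ ‖x‖`. [folklore] -/
theorem norm_mul_unit_le {u : Rˣ} (hu : UnitaryLike u) (x : R) : ‖x * (u : R)‖ ≤ ‖x‖ :=
  (norm_mul_le _ _).trans (by simpa using mul_le_mul_of_nonneg_left hu.1 (norm_nonneg x))

/-- Left multiplication by a unitary-like unit does not increase `‖· ‖`: `‖u·x‖ ≤ ‖x‖`. [folklore] -/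
theorem norm_unit_mul_le {u : Rˣ} (hu : UnitaryLike u) (x : R) : ‖(u : R) * x‖ ≤ ‖x‖ :=
  (norm_mul_le _ _).trans (by simpa using mul_le_mul_of_nonneg_right hu.1 (norm_nonneg x))

/-! ## §2  Relative tree transport along a path of tree bonds -/

/-- The RELATIVE axial gauge transformation along a path: `u 0 = 1`, `u (x+1) = h₀(x)⁻¹ · u x · h₁(x)` — chosen so that
configuration 1 transformed by `u` AGREES with configuration 0 on every path bond (`relTransport_fixes`).  Intended
[cell]: `h_c(x)` = bond variable of configuration `c` on the `x`-th bond of a tooth of the comb. [folklore] -/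
def relTransport (h₀ h₁ : ℕ → Rˣ) : ℕ → Rˣ
  | 0 => 1
  | x + 1 => (h₀ x)⁻¹ * relTransport h₀ h₁ x * h₁ x

/-- [folklore] -/
@[simp] theorem relTransport_zero (h₀ h₁ : ℕ → Rˣ) : relTransport h₀ h₁ 0 = 1 := rfl

/-- [folklore] -/
theorem relTransport_succ (h₀ h₁ : ℕ → Rˣ) (x : ℕ) :
    relTransport h₀ h₁ (x + 1) = (h₀ x)⁻¹ * relTransport h₀ h₁ x * h₁ x := rfl

/-- GAUGE FIXING ON THE TREE: the transformed bond variable `u_x · h₁(x) · u_{x+1}⁻¹` equals `h₀(x)`. [folklore] -/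
theorem relTransport_fixes (h₀ h₁ : ℕ → Rˣ) (x : ℕ) :
    relTransport h₀ h₁ x * h₁ x * (relTransport h₀ h₁ (x + 1))⁻¹ = h₀ x := by
  rw [relTransport_succ]; group

/-- ONE STEP of the relative chain: `‖h₀⁻¹·u·h₁ − 1‖ ≤ ‖u − 1‖ + ‖h₁ − h₀‖` for unitary-like `h₀` and `‖h₁‖ ≤ 1`.
[folklore] -/
theorem norm_relStep_sub_one_le {h₀ h₁ : Rˣ} (hh₀ : UnitaryLike h₀) (hh₁ : ‖(h₁ : R)‖ ≤ 1) (u : R) :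
    ‖((h₀⁻¹ : Rˣ) : R) * u * h₁ - 1‖ ≤ ‖u - 1‖ + ‖(h₁ : R) - h₀‖ := by
  have e : ((h₀⁻¹ : Rˣ) : R) * u * h₁ - 1 = ((h₀⁻¹ : Rˣ) : R) * ((u - 1) * h₁ + (h₁ - h₀)) := by
    have h := h₀.inv_mul
    calc ((h₀⁻¹ : Rˣ) : R) * u * h₁ - 1 = ((h₀⁻¹ : Rˣ) : R) * u * h₁ - ((h₀⁻¹ : Rˣ) : R) * h₀ := by rw [h]
      _ = _ := by noncomm_ring
  rw [e]
  calc ‖((h₀⁻¹ : Rˣ) : R) * ((u - 1) * ↑h₁ + (↑h₁ - ↑h₀))‖ ≤ ‖(u - 1) * ↑h₁ + (↑h₁ - ↑h₀)‖ :=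
        norm_unit_mul_le hh₀.inv _
    _ ≤ ‖(u - 1) * (h₁ : R)‖ + ‖(h₁ : R) - h₀‖ := norm_add_le _ _
    _ ≤ ‖u - 1‖ + ‖(h₁ : R) - h₀‖ := by
        gcongr
        exact (norm_mul_le _ _).trans (by simpa using mul_le_mul_of_nonneg_left hh₁ (norm_nonneg _))

/-- THE RELATIVE CHAIN COUNT: `‖u_n − 1‖ ≤ Σ_{x<n} ‖h₁(x) − h₀(x)‖` — LINEAR in the path length times the sup bond
deviation between the two configurations (the relative form of [Balaban1985Averaging] (46)). [folklore] -/
theorem norm_relTransport_sub_one_le [NormOneClass R] {h₀ h₁ : ℕ → Rˣ} (hh₀ : ∀ x, UnitaryLike (h₀ x))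
    (hh₁ : ∀ x, ‖(h₁ x : R)‖ ≤ 1) (n : ℕ) :
    ‖(relTransport h₀ h₁ n : R) - 1‖ ≤ ∑ x ∈ range n, ‖(h₁ x : R) - h₀ x‖ := by
  induction n with
  | zero => simp
  | succ n ih =>
    rw [relTransport_succ, Units.val_mul, Units.val_mul, sum_range_succ]
    exact (norm_relStep_sub_one_le (hh₀ n) (hh₁ n) _).trans (by linarith)

/-- Uniform form: bond deviations `≤ e` along a path of `n` bonds ⇒ `‖u_n − 1‖ ≤ n·e`. [folklore] -/
theorem norm_relTransport_sub_one_le_mul [NormOneClass R] {h₀ h₁ : ℕ → Rˣ} {e : ℝ}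
    (hh₀ : ∀ x, UnitaryLike (h₀ x)) (hh₁ : ∀ x, ‖(h₁ x : R)‖ ≤ 1) (he : ∀ x, ‖(h₁ x : R) - h₀ x‖ ≤ e) (n : ℕ) :
    ‖(relTransport h₀ h₁ n : R) - 1‖ ≤ n * e :=
  (norm_relTransport_sub_one_le hh₀ hh₁ n).trans <| (sum_le_sum fun x _ => he x).trans (by simp)

/-! ## §3  The ladder: transverse defect = ℓ¹-sum of relative plaquette deviations -/

section Ladder

variable (hb ht v : ℕ → Rˣ)

/-- Plaquette holonomy of the `m`-th square of the ladder, based at its bottom-left corner: bottom bond, right rung up,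
top bond backwards, left rung down. [folklore] -/
def plaq (m : ℕ) : Rˣ := hb m * v (m + 1) * (ht m)⁻¹ * (v m)⁻¹

/-- The ladder's plaquette convention is the direction chart's `basePlaq U₁ U₂ U₃ U₄ = U₁U₂U₃⁻¹U₄⁻¹` with
`U₁ = hb m`, `U₂ = v (m+1)`, `U₃ = ht m`, `U₄ = v m`. [folklore] -/
theorem plaq_eq_basePlaq (m : ℕ) : plaq hb ht v m = T4DirectionChart.basePlaq (hb m) (v (m + 1)) (ht m) (v m) := rfl

variable (v₀ v₁ : ℕ → Rˣ)

/-- Transverse defect at the `m`-th rung: `W(m) = v₁(m)·v₀(m)⁻¹` (configuration 1, already in relative axial gauge —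
horizontal bonds shared — against configuration 0). [folklore] -/
def defect (m : ℕ) : Rˣ := v₁ m * (v₀ m)⁻¹

/-- Identical configurations have no transverse defect. [folklore] -/
@[simp] theorem defect_self (m : ℕ) : defect v₀ v₀ m = 1 := by simp [defect]

/-- THE LADDER IDENTITY (relative non-abelian Stokes, one square):
`W(m+1) = hb(m)⁻¹ · (P₁(m) · W(m) · P₀(m)⁻¹) · hb(m)`. [folklore] -/
theorem defect_succ (m : ℕ) :
    defect v₀ v₁ (m + 1) = (hb m)⁻¹ * (plaq hb ht v₁ m * defect v₀ v₁ m * (plaq hb ht v₀ m)⁻¹) * hb m := by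
  simp only [defect, plaq]; group

variable {hb ht v₀ v₁}

/-- ONE RUNG: `‖W(m+1) − 1‖ ≤ ‖W(m) − 1‖ + ‖P₁(m) − P₀(m)‖` (conjugation isometry + telescoping with norm-≤1
factors). [folklore] -/
theorem norm_defect_succ_sub_one_le (hhb : ∀ m, UnitaryLike (hb m)) (hht : ∀ m, UnitaryLike (ht m))
    (hv₀ : ∀ m, UnitaryLike (v₀ m)) (hv₁ : ∀ m, UnitaryLike (v₁ m)) (m : ℕ) :
    ‖(defect v₀ v₁ (m + 1) : R) - 1‖ ≤
      ‖(defect v₀ v₁ m : R) - 1‖ + ‖(plaq hb ht v₁ m : R) - plaq hb ht v₀ m‖ := by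
  have hP₁ : UnitaryLike (plaq hb ht v₁ m) := (((hhb m).mul (hv₁ (m + 1))).mul (hht m).inv).mul (hv₁ m).inv
  have hP₀ : UnitaryLike (plaq hb ht v₀ m) := (((hhb m).mul (hv₀ (m + 1))).mul (hht m).inv).mul (hv₀ m).inv
  set W : R := (defect v₀ v₁ m : R)
  set P₁ : Rˣ := plaq hb ht v₁ m
  set P₀ : Rˣ := plaq hb ht v₀ m
  have e1 : (defect v₀ v₁ (m + 1) : R) = (((hb m)⁻¹ : Rˣ) : R) * ((P₁ : R) * W * ↑P₀⁻¹) * ↑((hb m)⁻¹)⁻¹ := by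
    rw [defect_succ hb ht v₀ v₁ m, inv_inv]; simp [W, P₁, P₀, mul_assoc]
  rw [e1, norm_conj_sub_one_eq (hhb m).inv]
  have e2 : (P₁ : R) * W * ↑P₀⁻¹ - 1 = (P₁ : R) * (W - 1) * ↑P₀⁻¹ + ((P₁ : R) - P₀) * ↑P₀⁻¹ := by
    have h := P₀.mul_inv
    calc (P₁ : R) * W * ↑P₀⁻¹ - 1 = (P₁ : R) * W * ↑P₀⁻¹ - (P₀ : R) * ↑P₀⁻¹ := by rw [h]
      _ = _ := by noncomm_ring
  rw [e2]
  calc ‖(P₁ : R) * (W - 1) * ↑P₀⁻¹ + ((P₁ : R) - P₀) * ↑P₀⁻¹‖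
      ≤ ‖(P₁ : R) * (W - 1) * ↑P₀⁻¹‖ + ‖((P₁ : R) - P₀) * ↑P₀⁻¹‖ := norm_add_le _ _
    _ ≤ ‖W - 1‖ + ‖(P₁ : R) - P₀‖ := by
        gcongr
        · exact (norm_mul_unit_le hP₀.inv _).trans (norm_unit_mul_le hP₁ _)
        · exact norm_mul_unit_le hP₀.inv _

/-- THE LADDER COUNT: if the first rung is a tree bond (`v₁ 0 = v₀ 0`, relative axial gauge from the spine) then
`‖W(n) − 1‖ ≤ Σ_{m<n} ‖P₁(m) − P₀(m)‖` — the transverse defect at distance `n` is the ℓ¹-sum of the relative plaquette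
deviations along the ladder. [folklore] -/
theorem norm_defect_sub_one_le_sum [NormOneClass R] (hhb : ∀ m, UnitaryLike (hb m)) (hht : ∀ m, UnitaryLike (ht m))
    (hv₀ : ∀ m, UnitaryLike (v₀ m)) (hv₁ : ∀ m, UnitaryLike (v₁ m)) (h0 : v₁ 0 = v₀ 0) (n : ℕ) :
    ‖(defect v₀ v₁ n : R) - 1‖ ≤ ∑ m ∈ range n, ‖(plaq hb ht v₁ m : R) - plaq hb ht v₀ m‖ := by
  induction n with
  | zero => simp [defect, h0]
  | succ n ih =>
    rw [sum_range_succ]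
    exact (norm_defect_succ_sub_one_le hhb hht hv₀ hv₁ n).trans (by linarith)

/-- Uniform form: relative plaquette deviations `≤ p` along a ladder of `n` squares ⇒ `‖W(n) − 1‖ ≤ n·p` — the
constant is the ladder LENGTH (the `C_P(R) = O(R)` of record `t4/T4-EST-NE1p-P1.md` §3 (T-⊥), sup-norm part).
[folklore] -/
theorem norm_defect_sub_one_le_mul [NormOneClass R] {p : ℝ} (hhb : ∀ m, UnitaryLike (hb m))
    (hht : ∀ m, UnitaryLike (ht m)) (hv₀ : ∀ m, UnitaryLike (v₀ m)) (hv₁ : ∀ m, UnitaryLike (v₁ m))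
    (h0 : v₁ 0 = v₀ 0) (hp : ∀ m, ‖(plaq hb ht v₁ m : R) - plaq hb ht v₀ m‖ ≤ p) (n : ℕ) :
    ‖(defect v₀ v₁ n : R) - 1‖ ≤ n * p :=
  (norm_defect_sub_one_le_sum hhb hht hv₀ hv₁ h0 n).trans <| (sum_le_sum fun m _ => hp m).trans (by simp)

end Ladder

/-! ## §4  The commutator cross term of the gauge fixing -/

/-- `‖u⁻¹ − 1‖ ≤ ‖u − 1‖` for unitary-like `u` (`u⁻¹ − 1 = u⁻¹(1 − u)`; `T4DirectionChart.GUnit.norm_inv_sub_one_le` by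
name). [folklore] -/
theorem norm_inv_sub_one_le {u : Rˣ} (hu : UnitaryLike u) : ‖((u⁻¹ : Rˣ) : R) - 1‖ ≤ ‖(u : R) - 1‖ :=
  T4DirectionChart.GUnit.norm_inv_sub_one_le hu

/-- THE CROSS TERM: the relative plaquette deviation AFTER the gauge fixing exceeds the raw one by at most
`2‖u − 1‖·‖P₀ − 1‖` — (relative transport, first-order small) × (base curvature, small): second order.
`u·P₁·u⁻¹ − P₀ = u(P₁ − P₀)u⁻¹ + (u − 1)(P₀ − 1)u⁻¹ + (P₀ − 1)(u⁻¹ − 1)`. [folklore] -/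
theorem norm_conj_sub_le {u : Rˣ} (hu : UnitaryLike u) (P₁ P₀ : R) :
    ‖(u : R) * P₁ * ↑u⁻¹ - P₀‖ ≤ ‖P₁ - P₀‖ + 2 * ‖(u : R) - 1‖ * ‖P₀ - 1‖ := by
  have e : (u : R) * P₁ * ↑u⁻¹ - P₀ =
      (u : R) * (P₁ - P₀) * ↑u⁻¹ + (((u : R) - 1) * (P₀ - 1) * ↑u⁻¹ + (P₀ - 1) * (((u⁻¹ : Rˣ) : R) - 1)) := by
    have h : ((u : R) - 1) * (P₀ - 1) * ↑u⁻¹ + (P₀ - 1) * (((u⁻¹ : Rˣ) : R) - 1) =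
        (u : R) * P₀ * ↑u⁻¹ - P₀ - ((u : R) * ↑u⁻¹ - 1) := by noncomm_ring
    rw [h, Units.mul_inv, sub_self, sub_zero]; noncomm_ring
  rw [e]
  have h1 : ‖(u : R) * (P₁ - P₀) * ↑u⁻¹‖ ≤ ‖P₁ - P₀‖ :=
    (norm_mul_unit_le hu.inv _).trans (norm_unit_mul_le hu _)
  have h2 : ‖((u : R) - 1) * (P₀ - 1) * ↑u⁻¹‖ ≤ ‖(u : R) - 1‖ * ‖P₀ - 1‖ :=
    (norm_mul_unit_le hu.inv _).trans (norm_mul_le _ _)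
  have h3 : ‖(P₀ - 1) * (((u⁻¹ : Rˣ) : R) - 1)‖ ≤ ‖P₀ - 1‖ * ‖(u : R) - 1‖ :=
    (norm_mul_le _ _).trans (mul_le_mul_of_nonneg_left (norm_inv_sub_one_le hu) (norm_nonneg _))
  calc _ ≤ ‖(u : R) * (P₁ - P₀) * ↑u⁻¹‖ + (‖((u : R) - 1) * (P₀ - 1) * ↑u⁻¹‖ + ‖(P₀ - 1) * (((u⁻¹ : Rˣ) : R) - 1)‖) :=
        (norm_add_le _ _).trans (add_le_add le_rfl (norm_add_le _ _))
    _ ≤ ‖P₁ - P₀‖ + (‖(u : R) - 1‖ * ‖P₀ - 1‖ + ‖P₀ - 1‖ * ‖(u : R) - 1‖) := by gcongr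
    _ = ‖P₁ - P₀‖ + 2 * ‖(u : R) - 1‖ * ‖P₀ - 1‖ := by ring

/-- The cross term in the chart's vocabulary: `‖transport u P₁ − P₀‖ ≤ ‖P₁ − P₀‖ + 2‖u − 1‖·‖P₀ − 1‖` for a G-valued
unit `u` (compare `T4DirectionChart.GUnit.norm_transport_sub_self_le`: `‖transport u A − A‖ ≤ 2‖u − 1‖·‖A‖`, the
case `P₁ = P₀ = A` up to the recentring `A ↦ A − 1`). [folklore] -/
theorem norm_transport_sub_le {u : Rˣ} (hu : T4DirectionChart.GUnit u) (P₁ P₀ : R) :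
    ‖T4DirectionChart.transport u P₁ - P₀‖ ≤ ‖P₁ - P₀‖ + 2 * ‖(u : R) - 1‖ * ‖P₀ - 1‖ :=
  norm_conj_sub_le hu P₁ P₀

/-- ASSEMBLED COUNT (the shape of input (I4)'s sup-norm part): along a ladder of `n` squares whose configuration-1
plaquettes are the conjugates `u(m)·P₁raw(m)·u(m)⁻¹` of the raw ones by the (unitary-like) relative transports at
their corners (hypothesis `hgf` — intended [cell]: based holonomies transform by conjugation at the base point), raw
relative plaquette deviations `≤ p`, base curvature `‖P₀(m) − 1‖ ≤ q` and transports `‖u(m) − 1‖ ≤ t` give the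
transverse defect `‖W(n) − 1‖ ≤ n·(p + 2·t·q)` — LINEAR in `n`, with the commutator correction displayed (and
`t ≤ ℓ·e` by `norm_relTransport_sub_one_le_mul`).  Nothing about Bałaban's window norm is asserted. [folklore] -/
theorem norm_defect_le_linear [NormOneClass R] {hb ht v₀ v₁ u : ℕ → Rˣ} {P₁raw : ℕ → R} {p q t : ℝ}
    (hhb : ∀ m, UnitaryLike (hb m)) (hht : ∀ m, UnitaryLike (ht m)) (hv₀ : ∀ m, UnitaryLike (v₀ m))
    (hv₁ : ∀ m, UnitaryLike (v₁ m)) (h0 : v₁ 0 = v₀ 0) (hu : ∀ m, UnitaryLike (u m))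
    (hgf : ∀ m, (plaq hb ht v₁ m : R) = (u m : R) * P₁raw m * ↑(u m)⁻¹)
    (hp : ∀ m, ‖P₁raw m - (plaq hb ht v₀ m : R)‖ ≤ p) (hq : ∀ m, ‖(plaq hb ht v₀ m : R) - 1‖ ≤ q)
    (htu : ∀ m, ‖(u m : R) - 1‖ ≤ t) (ht0 : 0 ≤ t) (n : ℕ) :
    ‖(defect v₀ v₁ n : R) - 1‖ ≤ n * (p + 2 * t * q) := by
  refine norm_defect_sub_one_le_mul hhb hht hv₀ hv₁ h0 (fun m => ?_) n
  rw [hgf m]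
  calc ‖(u m : R) * P₁raw m * ↑(u m)⁻¹ - (plaq hb ht v₀ m : R)‖
      ≤ ‖P₁raw m - (plaq hb ht v₀ m : R)‖ + 2 * ‖(u m : R) - 1‖ * ‖(plaq hb ht v₀ m : R) - 1‖ :=
        norm_conj_sub_le (hu m) _ _
    _ ≤ p + 2 * t * q := by
        have h1 := hp m; have h2 := htu m; have h3 := hq m
        gcongr

/-! ## §6  Differences: along the ladder (local) and across ladders (the covariant comb)

The DERIVATIVE part of input (I4) at the level of FIRST DIFFERENCES.  Along the ladder the difference of consecutive
defects is LOCAL (one relative plaquette deviation + small × defect, `norm_defect_succ_sub_defect_le`).  Across two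
adjacent ladders of the comb (teeth `y, y+1` and `y+1, y+2`, all horizontal bonds shared = relative axial gauge on the
full comb) the COVARIANT difference of the transverse defects — the upper one transported down along the base's
vertical bond `v₀(x,y)` — obeys a one-step recursion whose source terms are: the COVARIANT DIFFERENCE OF THE RELATIVE
PLAQUETTE DEVIATIONS `Δ(x,y) = v₀(x,y)·E(x,y+1)·v₀(x,y)⁻¹ − E(x,y)` (`covDev`; intended [cell]: `ξ³ ×` the covariant
gradient of the CURVATURE CHANGE — this is the typed form of the located missing input (O2c) "incl. gradients"), the
covariant difference of the BASE plaquettes `v₀·P₀(x,y+1)·v₀⁻¹ − P₀(x,y)` (`covBase`; [cell]: `ξ³ × ∇F₀`, the printed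
regularity class), and second-order products (`norm_covDiff_succ_le`); summed: `norm_covDiff_le`.  Nothing about
Bałaban's covariant derivatives or Hölder norms is asserted; second differences / Hölder quotients are NOT treated. -/

section Generic

/-- `‖P₁·W·P₀⁻¹ − 1‖ ≤ ‖W − 1‖ + ‖P₁ − P₀‖` for unitary-like `P₁, P₀` (the one-rung step of §3, stated alone).
[folklore] -/
theorem norm_triple_sub_one_le {P₁ P₀ : Rˣ} (hP₁ : UnitaryLike P₁) (hP₀ : UnitaryLike P₀) (W : R) :
    ‖(P₁ : R) * W * ↑P₀⁻¹ - 1‖ ≤ ‖W - 1‖ + ‖(P₁ : R) - P₀‖ := by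
  have e2 : (P₁ : R) * W * ↑P₀⁻¹ - 1 = (P₁ : R) * (W - 1) * ↑P₀⁻¹ + ((P₁ : R) - P₀) * ↑P₀⁻¹ := by
    have h := P₀.mul_inv
    calc (P₁ : R) * W * ↑P₀⁻¹ - 1 = (P₁ : R) * W * ↑P₀⁻¹ - (P₀ : R) * ↑P₀⁻¹ := by rw [h]
      _ = _ := by noncomm_ring
  rw [e2]
  calc ‖(P₁ : R) * (W - 1) * ↑P₀⁻¹ + ((P₁ : R) - P₀) * ↑P₀⁻¹‖
      ≤ ‖(P₁ : R) * (W - 1) * ↑P₀⁻¹‖ + ‖((P₁ : R) - P₀) * ↑P₀⁻¹‖ := norm_add_le _ _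
    _ ≤ ‖W - 1‖ + ‖(P₁ : R) - P₀‖ := by
        gcongr
        · exact (norm_mul_unit_le hP₀.inv _).trans (norm_unit_mul_le hP₁ _)
        · exact norm_mul_unit_le hP₀.inv _

/-- `‖P′⁻¹ − P⁻¹‖ ≤ ‖P′ − P‖` for unitary-like units (`P′⁻¹ − P⁻¹ = P′⁻¹(P − P′)P⁻¹`). [folklore] -/
theorem norm_inv_sub_inv_le {P' P : Rˣ} (hP' : UnitaryLike P') (hP : UnitaryLike P) :
    ‖((P'⁻¹ : Rˣ) : R) - ↑P⁻¹‖ ≤ ‖(P' : R) - P‖ := by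
  have e : ((P'⁻¹ : Rˣ) : R) - ↑P⁻¹ = ((P'⁻¹ : Rˣ) : R) * ((P : R) - P') * ↑P⁻¹ := by
    rw [mul_sub, sub_mul, mul_assoc _ (P : R) _, Units.mul_inv, mul_one, Units.inv_mul, one_mul]
  rw [e, norm_sub_rev (P' : R) (P : R)]
  exact (norm_mul_unit_le hP.inv _).trans (norm_unit_mul_le hP'.inv _)

/-- ALONG THE LADDER the difference of consecutive defects is LOCAL:
`‖W(m+1) − W(m)‖ ≤ ‖P₁(m) − P₀(m)‖ + 2(‖P₀(m) − 1‖ + ‖hb(m) − 1‖)·‖W(m) − 1‖`. [folklore] -/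
theorem norm_defect_succ_sub_defect_le {hb ht v₀ v₁ : ℕ → Rˣ} (hhb : ∀ m, UnitaryLike (hb m))
    (hht : ∀ m, UnitaryLike (ht m)) (hv₀ : ∀ m, UnitaryLike (v₀ m)) (hv₁ : ∀ m, UnitaryLike (v₁ m)) (m : ℕ) :
    ‖(defect v₀ v₁ (m + 1) : R) - defect v₀ v₁ m‖ ≤
      ‖(plaq hb ht v₁ m : R) - plaq hb ht v₀ m‖ +
        2 * (‖(plaq hb ht v₀ m : R) - 1‖ + ‖(hb m : R) - 1‖) * ‖(defect v₀ v₁ m : R) - 1‖ := by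
  have hP₁ : UnitaryLike (plaq hb ht v₁ m) := (((hhb m).mul (hv₁ (m + 1))).mul (hht m).inv).mul (hv₁ m).inv
  have hP₀ : UnitaryLike (plaq hb ht v₀ m) := (((hhb m).mul (hv₀ (m + 1))).mul (hht m).inv).mul (hv₀ m).inv
  set W : R := (defect v₀ v₁ m : R)
  set P₁ : Rˣ := plaq hb ht v₁ m
  set P₀ : Rˣ := plaq hb ht v₀ m
  set k : Rˣ := hb m
  -- `W(m+1) − W(m) = k⁻¹·(A − k·W·k⁻¹)·k` with `A = P₁WP₀⁻¹`
  have hd : (defect v₀ v₁ (m + 1) : R) = ((k⁻¹ : Rˣ) : R) * ((P₁ : R) * W * ↑P₀⁻¹) * k := by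
    rw [defect_succ hb ht v₀ v₁ m]; simp only [Units.val_mul, W, P₁, P₀, k]
  have hkW : ((k⁻¹ : Rˣ) : R) * ((k : R) * W * ↑k⁻¹) * k = W := by
    rw [mul_assoc, Units.inv_mul_cancel_right, Units.inv_mul_cancel_left]
  have e1 : (defect v₀ v₁ (m + 1) : R) - W =
      ((k⁻¹ : Rˣ) : R) * (((P₁ : R) * W * ↑P₀⁻¹) - ((k : R) * W * ↑k⁻¹)) * (k : R) := by
    rw [mul_sub, sub_mul, hkW, hd]
  rw [e1]
  have h1 : ‖((k⁻¹ : Rˣ) : R) * (((P₁ : R) * W * ↑P₀⁻¹) - ((k : R) * W * ↑k⁻¹)) * (k : R)‖ ≤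
      ‖((P₁ : R) * W * ↑P₀⁻¹) - ((k : R) * W * ↑k⁻¹)‖ :=
    (norm_mul_unit_le (hhb m) _).trans (norm_unit_mul_le (hhb m).inv _)
  -- `A − kWk⁻¹ = (A − 1 − (W − 1)) − (kWk⁻¹ − 1 − (W − 1))`, and `A − 1 = P₀(W−1)P₀⁻¹ + (P₁ − P₀)WP₀⁻¹`
  have e2 : ((P₁ : R) * W * ↑P₀⁻¹) - ((k : R) * W * ↑k⁻¹) =
      (((P₀ : R) * (W - 1) * ↑P₀⁻¹ - (W - 1)) + ((P₁ : R) - P₀) * W * ↑P₀⁻¹) -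
        ((k : R) * (W - 1) * ↑k⁻¹ - (W - 1)) := by
    have h0 := P₀.mul_inv; have hk := k.mul_inv
    calc ((P₁ : R) * W * ↑P₀⁻¹) - ((k : R) * W * ↑k⁻¹)
        = ((P₁ : R) * W * ↑P₀⁻¹) - ((k : R) * W * ↑k⁻¹) - ((P₀ : R) * ↑P₀⁻¹ - 1) + ((k : R) * ↑k⁻¹ - 1) := by
          rw [h0, hk, sub_self, sub_zero, add_zero]
      _ = _ := by noncomm_ring
  rw [e2] at h1 ⊢
  have h2 : ‖(P₀ : R) * (W - 1) * ↑P₀⁻¹ - (W - 1)‖ ≤ 2 * ‖(P₀ : R) - 1‖ * ‖W - 1‖ :=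
    T4DirectionChart.GUnit.norm_transport_sub_self_le hP₀ (W - 1)
  have h3 : ‖((P₁ : R) - P₀) * W * ↑P₀⁻¹‖ ≤ ‖(P₁ : R) - P₀‖ := by
    have hW : UnitaryLike (defect v₀ v₁ m) := (hv₁ m).mul (hv₀ m).inv
    exact (norm_mul_unit_le hP₀.inv _).trans (norm_mul_unit_le hW _)
  have h4 : ‖(k : R) * (W - 1) * ↑k⁻¹ - (W - 1)‖ ≤ 2 * ‖(k : R) - 1‖ * ‖W - 1‖ :=
    T4DirectionChart.GUnit.norm_transport_sub_self_le (hhb m) (W - 1)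
  calc _ ≤ ‖((P₀ : R) * (W - 1) * ↑P₀⁻¹ - (W - 1)) + ((P₁ : R) - P₀) * W * ↑P₀⁻¹‖ +
        ‖(k : R) * (W - 1) * ↑k⁻¹ - (W - 1)‖ := h1.trans (norm_sub_le _ _)
    _ ≤ (‖(P₀ : R) * (W - 1) * ↑P₀⁻¹ - (W - 1)‖ + ‖((P₁ : R) - P₀) * W * ↑P₀⁻¹‖) +
        ‖(k : R) * (W - 1) * ↑k⁻¹ - (W - 1)‖ := by gcongr; exact norm_add_le _ _
    _ ≤ (2 * ‖(P₀ : R) - 1‖ * ‖W - 1‖ + ‖(P₁ : R) - P₀‖) + 2 * ‖(k : R) - 1‖ * ‖W - 1‖ := by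
        gcongr
    _ = _ := by ring

/-- TWO TRIPLES COMPARED with the cancellation at `P₁ = P₀` kept: for unitary-like `P₀, P₀′, W, W′` (any `P₁, P₁′`),
`‖P₁′W′P₀′⁻¹ − P₁WP₀⁻¹‖ ≤ ‖W′ − W‖·(1 + ‖P₁ − P₀‖) + ‖(P₁′ − P₀′) − (P₁ − P₀)‖ + ‖P₀′ − P₀‖·(2‖W − 1‖ + ‖P₁ − P₀‖)`
(expansion `P₁WP₀⁻¹ − 1 = P₀(W − 1)P₀⁻¹ + (P₁ − P₀)WP₀⁻¹` on both triples). [folklore] -/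
theorem norm_triple_sub_triple_le {P₁ P₀ P₁' P₀' W W' : Rˣ} (hP₀ : UnitaryLike P₀) (hP₀' : UnitaryLike P₀')
    (hW : UnitaryLike W) (hW' : UnitaryLike W') :
    ‖(P₁' : R) * W' * ↑P₀'⁻¹ - (P₁ : R) * W * ↑P₀⁻¹‖ ≤
      ‖(W' : R) - W‖ * (1 + ‖(P₁ : R) - P₀‖) + ‖((P₁' : R) - P₀') - ((P₁ : R) - P₀)‖ +
        ‖(P₀' : R) - P₀‖ * (2 * ‖(W : R) - 1‖ + ‖(P₁ : R) - P₀‖) := by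
  -- abbreviations
  set w : R := (W : R) - 1
  set w' : R := (W' : R) - 1
  set E : R := (P₁ : R) - P₀
  set E' : R := (P₁' : R) - P₀'
  have hE : (P₁ : R) = P₀ + E := by simp [E]
  have hE' : (P₁' : R) = P₀' + E' := by simp [E']
  have hw : (W : R) = 1 + w := by simp [w]
  have hw' : (W' : R) = 1 + w' := by simp [w']
  -- the expansion, written so that only ring axioms and `P₀P₀⁻¹ = 1`, `P₀′P₀′⁻¹ = 1` are used
  have e : (P₁' : R) * W' * ↑P₀'⁻¹ - (P₁ : R) * W * ↑P₀⁻¹ =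
      ((P₀' : R) * (w' - w) * ↑P₀'⁻¹ + ((P₀' : R) - P₀) * w * ↑P₀'⁻¹ + (P₀ : R) * w * (↑P₀'⁻¹ - ↑P₀⁻¹)) +
      ((E' - E) * W' * ↑P₀'⁻¹ + E * ((W' : R) - W) * ↑P₀'⁻¹ + E * W * (↑P₀'⁻¹ - ↑P₀⁻¹)) := by
    have h0 := P₀.mul_inv; have h0' := P₀'.mul_inv
    have hwW : w' - w = (W' : R) - W := by simp [w, w']
    rw [hwW]
    calc (P₁' : R) * W' * ↑P₀'⁻¹ - (P₁ : R) * W * ↑P₀⁻¹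
        = (P₁' : R) * W' * ↑P₀'⁻¹ - (P₁ : R) * W * ↑P₀⁻¹ - ((P₀' : R) * ↑P₀'⁻¹ - 1) + ((P₀ : R) * ↑P₀⁻¹ - 1) := by
          rw [h0, h0', sub_self, sub_zero, add_zero]
      _ = _ := by rw [hE, hE', hw, hw']; noncomm_ring
  rw [e]
  have hWW : ‖(W' : R) - W‖ = ‖w' - w‖ := by simp [w, w']
  have i0 : ‖((P₀'⁻¹ : Rˣ) : R) - ↑P₀⁻¹‖ ≤ ‖(P₀' : R) - P₀‖ := norm_inv_sub_inv_le hP₀' hP₀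
  have t1 : ‖(P₀' : R) * (w' - w) * ↑P₀'⁻¹‖ ≤ ‖(W' : R) - W‖ := by
    rw [hWW]; exact (norm_mul_unit_le hP₀'.inv _).trans (norm_unit_mul_le hP₀' _)
  have t2 : ‖((P₀' : R) - P₀) * w * ↑P₀'⁻¹‖ ≤ ‖(P₀' : R) - P₀‖ * ‖w‖ :=
    (norm_mul_unit_le hP₀'.inv _).trans (norm_mul_le _ _)
  have t3 : ‖(P₀ : R) * w * (↑P₀'⁻¹ - ↑P₀⁻¹)‖ ≤ ‖w‖ * ‖(P₀' : R) - P₀‖ := by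
    calc ‖(P₀ : R) * w * (↑P₀'⁻¹ - ↑P₀⁻¹)‖ ≤ ‖(P₀ : R) * w‖ * ‖((P₀'⁻¹ : Rˣ) : R) - ↑P₀⁻¹‖ := norm_mul_le _ _
      _ ≤ ‖w‖ * ‖(P₀' : R) - P₀‖ := by
          gcongr
          exact norm_unit_mul_le hP₀ _
  have t4 : ‖(E' - E) * (W' : R) * ↑P₀'⁻¹‖ ≤ ‖E' - E‖ :=
    (norm_mul_unit_le hP₀'.inv _).trans (norm_mul_unit_le hW' _)
  have t5 : ‖E * ((W' : R) - W) * ↑P₀'⁻¹‖ ≤ ‖E‖ * ‖(W' : R) - W‖ :=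
    (norm_mul_unit_le hP₀'.inv _).trans (norm_mul_le _ _)
  have t6 : ‖E * (W : R) * (↑P₀'⁻¹ - ↑P₀⁻¹)‖ ≤ ‖E‖ * ‖(P₀' : R) - P₀‖ := by
    calc ‖E * (W : R) * (↑P₀'⁻¹ - ↑P₀⁻¹)‖ ≤ ‖E * (W : R)‖ * ‖((P₀'⁻¹ : Rˣ) : R) - ↑P₀⁻¹‖ := norm_mul_le _ _
      _ ≤ ‖E‖ * ‖(P₀' : R) - P₀‖ := by
          gcongr
          exact norm_mul_unit_le hW _
  calc _ ≤ (‖(P₀' : R) * (w' - w) * ↑P₀'⁻¹‖ + ‖((P₀' : R) - P₀) * w * ↑P₀'⁻¹‖ +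
          ‖(P₀ : R) * w * (↑P₀'⁻¹ - ↑P₀⁻¹)‖) +
        (‖(E' - E) * (W' : R) * ↑P₀'⁻¹‖ + ‖E * ((W' : R) - W) * ↑P₀'⁻¹‖ + ‖E * (W : R) * (↑P₀'⁻¹ - ↑P₀⁻¹)‖) :=
        (norm_add_le _ _).trans (add_le_add (norm_add₃_le) (norm_add₃_le))
    _ ≤ (‖(W' : R) - W‖ + ‖(P₀' : R) - P₀‖ * ‖w‖ + ‖w‖ * ‖(P₀' : R) - P₀‖) +
        (‖E' - E‖ + ‖E‖ * ‖(W' : R) - W‖ + ‖E‖ * ‖(P₀' : R) - P₀‖) := by gcongr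
    _ = _ := by ring

end Generic

section Comb

variable (h v₀ v₁ : ℕ → ℕ → Rˣ)

/-- The plaquette of configuration `v` (verticals; horizontals `h` shared) at `(x, y)`: the `x`-th square of ladder
`y` (teeth `y` below, `y+1` above), `h(x,y)·v(x+1,y)·h(x,y+1)⁻¹·v(x,y)⁻¹`. [folklore] -/
def plaq₂ (v : ℕ → ℕ → Rˣ) (x y : ℕ) : Rˣ := plaq (fun m => h m y) (fun m => h m (y + 1)) (fun m => v m y) x

/-- The transverse defect at the vertical bond `(x, y)`: `W_y(x) = v₁(x,y)·v₀(x,y)⁻¹`. [folklore] -/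
def defect₂ (x y : ℕ) : Rˣ := defect (fun m => v₀ m y) (fun m => v₁ m y) x

/-- THE COVARIANT DIFFERENCE ACROSS LADDERS: the defect of ladder `y+1` at `x`, transported DOWN along the base's
vertical bond `v₀(x,y)`, minus the defect of ladder `y` at `x`.  Intended [cell]: `ξ²` times the covariant
`y`-difference quotient of the transverse potential's `y`-component (the `|∇^ξ𝐀⊥|` entry of the window (3.31), one
direction); nothing printed is asserted. [folklore] -/
def covDiff (x y : ℕ) : R :=
  T4DirectionChart.transport (v₀ x y) (defect₂ v₀ v₁ x (y + 1) : R) - (defect₂ v₀ v₁ x y : R)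

/-- The relative plaquette deviation `E(x,y) = P₁(x,y) − P₀(x,y)`. [folklore] -/
def dev (x y : ℕ) : R := (plaq₂ h v₁ x y : R) - (plaq₂ h v₀ x y : R)

/-- THE SOURCE TERM: the covariant `y`-difference of the relative plaquette deviations,
`Δ(x,y) = v₀(x,y)·E(x,y+1)·v₀(x,y)⁻¹ − E(x,y)`.  Intended [cell]: `ξ³ ×` the covariant gradient of the CURVATURE
CHANGE between the two configurations — the typed form of the located input (O2c) "second-order small INCLUDING
gradients" (record `t4/T4-EST-NE1p-P1.md` §4); a HYPOTHESIS wherever sized. [folklore] -/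
def covDev (x y : ℕ) : R := T4DirectionChart.transport (v₀ x y) (dev h v₀ v₁ x (y + 1)) - dev h v₀ v₁ x y

/-- The covariant `y`-difference of the BASE plaquettes, `v₀(x,y)·P₀(x,y+1)·v₀(x,y)⁻¹ − P₀(x,y)`.  Intended [cell]:
`ξ³ × ∇F₀`, small in the printed regularity class; a HYPOTHESIS wherever sized. [folklore] -/
def covBase (x y : ℕ) : R :=
  T4DirectionChart.transport (v₀ x y) (plaq₂ h v₀ x (y + 1) : R) - (plaq₂ h v₀ x y : R)

/-- At the spine (`x = 0`, vertical bonds on the tree: `v₁ 0 · = v₀ 0 ·`) the covariant difference vanishes.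
[folklore] -/
theorem covDiff_zero (hsp : ∀ y, v₁ 0 y = v₀ 0 y) (y : ℕ) : covDiff v₀ v₁ 0 y = 0 := by
  simp [covDiff, defect₂, defect, hsp, T4DirectionChart.transport]

/-- THE TWO-LADDER IDENTITY (units): the upper defect at `x+1` transported down along `v₀(x+1,y)` equals
`h(x,y)⁻¹ · (P₀ · [P₁↓ · W↓ · P₀↓⁻¹] · P₀⁻¹) · h(x,y)` with `P₀ = P₀(x,y)`, `↓` = transport down along `v₀(x,y)` of
the ladder-`(y+1)` data at `x` — because `v₀(x+1,y)·h(x,y+1)⁻¹ = h(x,y)⁻¹·P₀(x,y)·v₀(x,y)`. [folklore] -/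
theorem covariant_succ (x y : ℕ) :
    v₀ (x + 1) y * defect₂ v₀ v₁ (x + 1) (y + 1) * (v₀ (x + 1) y)⁻¹ =
      (h x y)⁻¹ * (plaq₂ h v₀ x y *
        ((v₀ x y * plaq₂ h v₁ x (y + 1) * (v₀ x y)⁻¹) * (v₀ x y * defect₂ v₀ v₁ x (y + 1) * (v₀ x y)⁻¹) *
          (v₀ x y * plaq₂ h v₀ x (y + 1) * (v₀ x y)⁻¹)⁻¹) * (plaq₂ h v₀ x y)⁻¹) * h x y := by
  simp only [defect₂, plaq₂, defect, plaq]; group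

variable {h v₀ v₁}

/-- THE ONE-STEP RECURSION ACROSS LADDERS: with `D = covDiff`, `E = dev`, `Δ = covDev`, `B = covBase`,
`w = W_y(x) − 1`, `P₀ = P₀(x,y)`:
`‖D(x+1,y)‖ ≤ ‖D(x,y)‖·(1 + ‖E(x,y)‖) + ‖Δ(x,y)‖ + ‖B(x,y)‖·(2‖w‖ + ‖E(x,y)‖) + 2‖P₀ − 1‖·(‖w‖ + ‖E(x,y)‖)`
— the source is the covariant gradient of the curvature change `Δ`; everything else is (small) × (first order).
[folklore] -/
theorem norm_covDiff_succ_le (hh : ∀ x y, UnitaryLike (h x y)) (hv₀ : ∀ x y, UnitaryLike (v₀ x y))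
    (hv₁ : ∀ x y, UnitaryLike (v₁ x y)) (x y : ℕ) :
    ‖covDiff v₀ v₁ (x + 1) y‖ ≤
      ‖covDiff v₀ v₁ x y‖ * (1 + ‖dev h v₀ v₁ x y‖) + ‖covDev h v₀ v₁ x y‖ +
        ‖covBase h v₀ x y‖ * (2 * ‖(defect₂ v₀ v₁ x y : R) - 1‖ + ‖dev h v₀ v₁ x y‖) +
        2 * ‖(plaq₂ h v₀ x y : R) - 1‖ * (‖(defect₂ v₀ v₁ x y : R) - 1‖ + ‖dev h v₀ v₁ x y‖) := by
  -- unitary-likeness of every composite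
  have hP : ∀ (v : ℕ → ℕ → Rˣ), (∀ x y, UnitaryLike (v x y)) → ∀ x y, UnitaryLike (plaq₂ h v x y) :=
    fun v hv x y => (((hh x y).mul (hv (x + 1) y)).mul (hh x (y + 1)).inv).mul (hv x y).inv
  have hW : ∀ x y, UnitaryLike (defect₂ v₀ v₁ x y) := fun x y => (hv₁ x y).mul (hv₀ x y).inv
  set u : Rˣ := v₀ x y
  set k : Rˣ := h x y
  set P₀ : Rˣ := plaq₂ h v₀ x y
  set P₁ : Rˣ := plaq₂ h v₁ x y
  set W : Rˣ := defect₂ v₀ v₁ x y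
  set P₀' : Rˣ := u * plaq₂ h v₀ x (y + 1) * u⁻¹
  set P₁' : Rˣ := u * plaq₂ h v₁ x (y + 1) * u⁻¹
  set W' : Rˣ := u * defect₂ v₀ v₁ x (y + 1) * u⁻¹
  have hu : UnitaryLike u := hv₀ x y
  have hP₀ : UnitaryLike P₀ := hP v₀ hv₀ x y
  have hP₁ : UnitaryLike P₁ := hP v₁ hv₁ x y
  have hWu : UnitaryLike W := hW x y
  have hP₀' : UnitaryLike P₀' := (hu.mul (hP v₀ hv₀ x (y + 1))).mul hu.inv
  have hP₁' : UnitaryLike P₁' := (hu.mul (hP v₁ hv₁ x (y + 1))).mul hu.inv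
  have hW' : UnitaryLike W' := (hu.mul (hW x (y + 1))).mul hu.inv
  -- the dictionary between the `transport`ed ring elements and the conjugated units
  have cW' : T4DirectionChart.transport u (defect₂ v₀ v₁ x (y + 1) : R) = (W' : R) := by
    simp [W', T4DirectionChart.transport, Units.val_mul]
  have cP₀' : T4DirectionChart.transport u (plaq₂ h v₀ x (y + 1) : R) = (P₀' : R) := by
    simp [P₀', T4DirectionChart.transport, Units.val_mul]
  have cP₁' : T4DirectionChart.transport u (plaq₂ h v₁ x (y + 1) : R) = (P₁' : R) := by
    simp [P₁', T4DirectionChart.transport, Units.val_mul]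
  have hD : covDiff v₀ v₁ x y = (W' : R) - W := by simp only [covDiff, cW', W, u]
  have hΔ : covDev h v₀ v₁ x y = ((P₁' : R) - P₀') - ((P₁ : R) - P₀) := by
    simp only [covDev, dev, T4DirectionChart.transport_sub, cP₁', cP₀', P₁, P₀, u]
  have hB : covBase h v₀ x y = (P₀' : R) - P₀ := by simp only [covBase, cP₀', P₀, u]
  have hE : dev h v₀ v₁ x y = (P₁ : R) - P₀ := rfl
  -- step 1: the identity `D(x+1,y) = k⁻¹ · (P₀·A′·P₀⁻¹ − A) · k`
  set A : R := (P₁ : R) * W * ↑P₀⁻¹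
  set A' : R := (P₁' : R) * W' * ↑P₀'⁻¹
  have ha : T4DirectionChart.transport (v₀ (x + 1) y) (defect₂ v₀ v₁ (x + 1) (y + 1) : R) =
      ((k⁻¹ : Rˣ) : R) * ((P₀ : R) * A' * ↑P₀⁻¹) * k := by
    have e := congrArg Units.val (covariant_succ h v₀ v₁ x y)
    simp only [Units.val_mul] at e
    simp only [T4DirectionChart.transport, A', e, k, P₀, P₁', W', P₀', u, Units.val_mul, mul_inv_rev, inv_inv,
      mul_assoc]
  have hb : (defect₂ v₀ v₁ (x + 1) y : R) = ((k⁻¹ : Rˣ) : R) * A * k := by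
    have e : defect₂ v₀ v₁ (x + 1) y = k⁻¹ * (P₁ * W * P₀⁻¹) * k :=
      defect_succ (fun m => h m y) (fun m => h m (y + 1)) (fun m => v₀ m y) (fun m => v₁ m y) x
    rw [e]; simp only [Units.val_mul, A]
  have e1 : covDiff v₀ v₁ (x + 1) y = ((k⁻¹ : Rˣ) : R) * ((P₀ : R) * A' * ↑P₀⁻¹ - A) * k := by
    rw [covDiff, ha, hb]; noncomm_ring
  -- step 2: norms
  have n1 : ‖covDiff v₀ v₁ (x + 1) y‖ ≤ ‖(P₀ : R) * A' * ↑P₀⁻¹ - A‖ := by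
    rw [e1]; exact (norm_mul_unit_le (hh x y) _).trans (norm_unit_mul_le (hh x y).inv _)
  have n2 : ‖(P₀ : R) * A' * ↑P₀⁻¹ - A‖ ≤ ‖A' - A‖ + 2 * ‖(P₀ : R) - 1‖ * ‖A - 1‖ := norm_conj_sub_le hP₀ A' A
  have n3 : ‖A - 1‖ ≤ ‖(W : R) - 1‖ + ‖(P₁ : R) - P₀‖ := norm_triple_sub_one_le hP₁ hP₀ (W : R)
  have n4 : ‖A' - A‖ ≤ ‖(W' : R) - W‖ * (1 + ‖(P₁ : R) - P₀‖) + ‖((P₁' : R) - P₀') - ((P₁ : R) - P₀)‖ +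
      ‖(P₀' : R) - P₀‖ * (2 * ‖(W : R) - 1‖ + ‖(P₁ : R) - P₀‖) :=
    norm_triple_sub_triple_le hP₀ hP₀' hWu hW'
  rw [hD, hΔ, hB, hE]
  have hq : 0 ≤ ‖(P₀ : R) - 1‖ := norm_nonneg _
  calc ‖covDiff v₀ v₁ (x + 1) y‖ ≤ ‖A' - A‖ + 2 * ‖(P₀ : R) - 1‖ * ‖A - 1‖ := n1.trans n2
    _ ≤ _ := by
        have := mul_le_mul_of_nonneg_left n3 (by positivity : (0 : ℝ) ≤ 2 * ‖(P₀ : R) - 1‖)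
        linarith [n4, this]

/-- THE SUMMED FORM (Grönwall along the tooth).  Uniform data: relative plaquette deviations `‖E‖ ≤ p`, their
covariant `y`-differences `‖Δ‖ ≤ g`, base covariant differences `‖B‖ ≤ q′`, base curvature `‖P₀ − 1‖ ≤ q`, spine
bonds on the tree.  Then along the tooth, at distance `x`,
`‖D(x,y)‖ ≤ (1 + p)^x · x · (g + (2x + 1)·p·q′ + 2(x + 1)·p·q)`:
LINEAR in `x` times the gradient source `g`, plus `x²`-order products (deviation × base curvature data) — the
commutator content of a COVARIANT derivative; `(1 + p)^x ≤ e` for `x·p ≤ 1`.  Reading [cell]: `|∇^ξ_y 𝐀⊥_y| ≲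
R·|∇δF| + R²·(|F₀| + ξ|∇F₀|)·|δF|`; nothing printed is asserted. [folklore] -/
theorem norm_covDiff_le [NormOneClass R] {p g q q' : ℝ} (hh : ∀ x y, UnitaryLike (h x y))
    (hv₀ : ∀ x y, UnitaryLike (v₀ x y)) (hv₁ : ∀ x y, UnitaryLike (v₁ x y)) (hsp : ∀ y, v₁ 0 y = v₀ 0 y)
    (hp0 : 0 ≤ p) (hq0 : 0 ≤ q) (hq0' : 0 ≤ q') (hg0 : 0 ≤ g)
    (hp : ∀ x y, ‖dev h v₀ v₁ x y‖ ≤ p) (hg : ∀ x y, ‖covDev h v₀ v₁ x y‖ ≤ g)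
    (hq' : ∀ x y, ‖covBase h v₀ x y‖ ≤ q') (hq : ∀ x y, ‖(plaq₂ h v₀ x y : R) - 1‖ ≤ q) (x y : ℕ) :
    ‖covDiff v₀ v₁ x y‖ ≤ (1 + p) ^ x * x * (g + (2 * x + 1) * p * q' + 2 * (x + 1) * p * q) := by
  -- the transverse defect along ladder `y` is first order: `‖W_y(x) − 1‖ ≤ x·p`
  have hw : ∀ x, ‖(defect₂ v₀ v₁ x y : R) - 1‖ ≤ x * p := fun x =>
    norm_defect_sub_one_le_mul (hb := fun m => h m y) (ht := fun m => h m (y + 1)) (fun m => hh m y)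
      (fun m => hh m (y + 1)) (fun m => hv₀ m y) (fun m => hv₁ m y) (hsp y) (fun m => hp m y) x
  induction x with
  | zero => simp [covDiff_zero v₀ v₁ hsp]
  | succ x ih =>
    have step := norm_covDiff_succ_le hh hv₀ hv₁ x y
    have hD0 : 0 ≤ ‖covDiff v₀ v₁ x y‖ := norm_nonneg _
    have hE := hp x y; have hG := hg x y; have hBq := hq' x y; have hQ := hq x y; have hwx := hw x
    have hE0 : 0 ≤ ‖dev h v₀ v₁ x y‖ := norm_nonneg _
    have hB0 : 0 ≤ ‖covBase h v₀ x y‖ := norm_nonneg _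
    have hw0 : 0 ≤ ‖(defect₂ v₀ v₁ x y : R) - 1‖ := norm_nonneg _
    have hP0 : 0 ≤ ‖(plaq₂ h v₀ x y : R) - 1‖ := norm_nonneg _
    -- `c(x) := g + (2x+1)pq′ + 2(x+1)pq` dominates the source terms and is monotone in `x`
    set c : ℕ → ℝ := fun n => g + (2 * n + 1) * p * q' + 2 * (n + 1) * p * q with hc
    have hcx : 0 ≤ c x := by simp only [hc]; positivity
    have hmono : c x ≤ c (x + 1) := by simp only [hc]; push_cast; nlinarith
    have hpow : 1 ≤ (1 + p) ^ (x + 1) := one_le_pow₀ (by linarith)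
    have hpow0 : 0 ≤ (1 + p) ^ x := by positivity
    -- source ≤ c x
    have hsrc : ‖covDev h v₀ v₁ x y‖ +
        ‖covBase h v₀ x y‖ * (2 * ‖(defect₂ v₀ v₁ x y : R) - 1‖ + ‖dev h v₀ v₁ x y‖) +
        2 * ‖(plaq₂ h v₀ x y : R) - 1‖ * (‖(defect₂ v₀ v₁ x y : R) - 1‖ + ‖dev h v₀ v₁ x y‖) ≤ c x := by
      simp only [hc]
      have a1 : ‖covBase h v₀ x y‖ * (2 * ‖(defect₂ v₀ v₁ x y : R) - 1‖ + ‖dev h v₀ v₁ x y‖) ≤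
          q' * (2 * (x * p) + p) := by gcongr
      have a2 : 2 * ‖(plaq₂ h v₀ x y : R) - 1‖ * (‖(defect₂ v₀ v₁ x y : R) - 1‖ + ‖dev h v₀ v₁ x y‖) ≤
          2 * q * (x * p + p) := by gcongr
      nlinarith [a1, a2, hG]
    have hlin : ‖covDiff v₀ v₁ x y‖ * (1 + ‖dev h v₀ v₁ x y‖) ≤ ‖covDiff v₀ v₁ x y‖ * (1 + p) := by gcongr
    have ih' : ‖covDiff v₀ v₁ x y‖ ≤ (1 + p) ^ x * x * c x := ih
    calc ‖covDiff v₀ v₁ (x + 1) y‖ ≤ ‖covDiff v₀ v₁ x y‖ * (1 + p) + c x := by linarith [step, hsrc, hlin]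
      _ ≤ (1 + p) ^ x * x * c x * (1 + p) + c x := by gcongr
      _ = (1 + p) ^ (x + 1) * (x * c x) + 1 * c x := by ring
      _ ≤ (1 + p) ^ (x + 1) * (x * c (x + 1)) + (1 + p) ^ (x + 1) * c (x + 1) := by
          gcongr
      _ = (1 + p) ^ (x + 1) * ↑(x + 1) * c (x + 1) := by push_cast; ring

end Comb

/-! ## §5  Non-vacuity -/

/-- The shapes are inhabited: in `ℂ` the unit `1` is unitary-like, and a ladder with identical rungs has defect `1`
and the count `0 ≤ n·p` is consistent. [folklore] -/
example : UnitaryLike (1 : ℂˣ) := UnitaryLike.one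

/-- A unit of norm one with inverse of norm one (e.g. a phase) is unitary-like. [folklore] -/
theorem unitaryLike_of_norm_eq_one {u : Rˣ} (h : ‖(u : R)‖ = 1) (h' : ‖((u⁻¹ : Rˣ) : R)‖ = 1) : UnitaryLike u :=
  ⟨h.le, h'.le⟩

/-! ## §7  Scaling of block-summed directions — the abelian 1-D toy of input (O2d)  [folklore]

XREAD C-pv20-33 (chart owner pv20) objected, correctly, that the chart lemma
`T4DirectionChart.norm_movedPlaq_sub_one_le_xi_sq` gives the curvature CHANGE of a moved configuration at FIRST
order in the chart parameter with coefficient the direction's covariant CURL, so that the cell's rate-table reading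
"transverse defect ∝ L^{−2(k−j)}" needs the curl of the direction ONE FACTOR below its amplitude in the birth frame.
The elementary mechanism behind that factor is recorded here on abstract data (no claim about Bałaban's averaging
`Q` or his window norms): a fine 1-form `f : ℕ → M` along a line whose consecutive differences are `≤ s` ("smooth on
the fine scale": gradient `s`) and whose values are `≤ a`, block-summed over `N` consecutive fine bonds
(`blockSum f N x = Σ_{i<N} f (x+i)`, the per-coarse-bond amplitude), has coarse amplitude `≤ N·a` but coarse
DIFFERENCE over a displacement of one block `≤ N²·s` — quadratic, i.e. one factor `N·s/a` below the amplitude.  With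
`a ≈ s` (amplitude and unit-scale gradient bounded by the same constant, the format of [Balaban1987RG1] (3.32)
p. 277 "|A|, |∇^ηA|, ‖A‖_{1,β} < 2(α₂ + B₃O(1)Mα₀)" for Bałaban's own direction) and `N = L^{j}η/η`, this is the
2-form scaling `(L^{j}η)²` versus the printed 1-form amplitude "|B| < O(1)L^{j}η" (p. 277).  What is NOT toy: the
commutation of the non-abelian averaging with covariant differences (an UNPRINTED cell hypothesis — [Balaban1985Averaging]
(44)–(47) print the one-step regularity of the averaged field in a local axial gauge and the chain count, not a
commutation identity; v5 DOCFIX, `t4/CITED-FACTS-T4.md` v1) and the two fine bounds for the cell's observable-moved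
direction — record `t4/T4-EST-NE1p-P1.md` §4 (O2d); for the transport RATE both are bypassed by the crude comb route of
`T4BlockTransport` §5 (record §3, v1.3). -/

section BlockSum

variable {M : Type*} [SeminormedAddCommGroup M]

/-- The block sum of `N` consecutive values of a fine 1-form starting at `x` (per-coarse-bond amplitude). [folklore] -/
def blockSum (f : ℕ → M) (N x : ℕ) : M := ∑ i ∈ Finset.range N, f (x + i)

/-- [folklore] Telescoping: a fine 1-form with consecutive differences `≤ s` moves by at most `m·s` over `m` steps. -/
theorem norm_shift_sub_le (f : ℕ → M) {s : ℝ} (hs : ∀ i, ‖f (i + 1) - f i‖ ≤ s) (x m : ℕ) :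
    ‖f (x + m) - f x‖ ≤ m * s := by
  induction m with
  | zero => simp
  | succ m ih =>
    calc ‖f (x + (m + 1)) - f x‖ = ‖(f (x + m + 1) - f (x + m)) + (f (x + m) - f x)‖ := by
          rw [← add_assoc, sub_add_sub_cancel]
      _ ≤ ‖f (x + m + 1) - f (x + m)‖ + ‖f (x + m) - f x‖ := norm_add_le _ _
      _ ≤ s + m * s := add_le_add (hs _) ih
      _ = (m + 1 : ℕ) * s := by push_cast; ring

/-- [folklore] Coarse AMPLITUDE: the block sum of `N` values of size `≤ a` has size `≤ N·a` (1-form scaling). -/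
theorem norm_blockSum_le (f : ℕ → M) {a : ℝ} (ha : ∀ i, ‖f i‖ ≤ a) (N x : ℕ) :
    ‖blockSum f N x‖ ≤ N * a := by
  unfold blockSum
  calc ‖∑ i ∈ Finset.range N, f (x + i)‖ ≤ ∑ i ∈ Finset.range N, ‖f (x + i)‖ := norm_sum_le _ _
    _ ≤ ∑ _i ∈ Finset.range N, a := Finset.sum_le_sum fun i _ => ha _
    _ = N * a := by simp

/-- [folklore] Coarse DIFFERENCE over a displacement of `m` fine steps: `≤ N·m·s`. -/
theorem norm_blockSum_shift_sub_le (f : ℕ → M) {s : ℝ} (hs : ∀ i, ‖f (i + 1) - f i‖ ≤ s) (N x m : ℕ) :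
    ‖blockSum f N (x + m) - blockSum f N x‖ ≤ N * (m * s) := by
  unfold blockSum
  rw [← Finset.sum_sub_distrib]
  calc ‖∑ i ∈ Finset.range N, (f (x + m + i) - f (x + i))‖
        ≤ ∑ i ∈ Finset.range N, ‖f (x + m + i) - f (x + i)‖ := norm_sum_le _ _
    _ ≤ ∑ _i ∈ Finset.range N, m * s := Finset.sum_le_sum fun i _ => by
          have h := norm_shift_sub_le f hs (x + i) m
          rwa [show x + i + m = x + m + i by omega] at h
    _ = N * (m * s) := by simp

/-- [folklore] THE 2-FORM SCALING OF THE TOY: over a displacement of ONE BLOCK (`m = N`) the coarse difference is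
`≤ N²·s` — one factor `N·s/a` below the coarse amplitude `N·a` of `norm_blockSum_le`. -/
theorem norm_blockSum_block_shift_sub_le (f : ℕ → M) {s : ℝ} (hs : ∀ i, ‖f (i + 1) - f i‖ ≤ s) (N x : ℕ) :
    ‖blockSum f N (x + N) - blockSum f N x‖ ≤ (N : ℝ) ^ 2 * s := by
  have h := norm_blockSum_shift_sub_le f hs N x N
  calc ‖blockSum f N (x + N) - blockSum f N x‖ ≤ N * (N * s) := h
    _ = (N : ℝ) ^ 2 * s := by ring

/-- Non-vacuity [folklore]: the linear fine 1-form `f i = i • v` (constant gradient `‖v‖`) realises the quadratic law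
exactly up to the norm: its block difference over one block is `N² • v`. -/
theorem blockSum_linear_block_shift (v : M) (N x : ℕ) :
    blockSum (fun i => (i : ℤ) • v) N (x + N) - blockSum (fun i => (i : ℤ) • v) N x = ((N : ℤ) ^ 2) • v := by
  unfold blockSum
  rw [← Finset.sum_sub_distrib]
  have : ∀ i ∈ Finset.range N, ((x + N + i : ℕ) : ℤ) • v - ((x + i : ℕ) : ℤ) • v = (N : ℤ) • v := by
    intro i _
    rw [← sub_smul]
    congr 1
    push_cast
    ring
  rw [Finset.sum_congr rfl this, Finset.sum_const, Finset.card_range, ← natCast_zsmul, smul_smul]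
  congr 1
  ring

end BlockSum

/-! ## §8  Rebasing the relative gauge: block patching (the ladder-level form of input (O2b))  [folklore]

The relative axial gauge `relTransport h₀ h₁` is based at rung `0`.  Re-based at rung `x₁` (the local gauge of the
block starting there) it differs from the global one by a TRANSITION FACTOR `c_m = B_m⁻¹ · u(x₁) · B_m`, the global
gauge's value at the block entrance conjugated by the base transport `B_m = h₀(x₁) ⋯ h₀(x₁+m−1)` along the block
(`relTransport_rebase`).  For unitary-like base bonds the transition factor has CONSTANT deviation from `1`,
`‖c_m − 1‖ = ‖u(x₁) − 1‖` (`norm_transition_sub_one_eq`), and is COVARIANTLY ALMOST CONSTANT along the block: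
`‖c_{m+1} − c_m‖ ≤ 2·‖h₀(x₁+m) − 1‖·‖u(x₁) − 1‖` (`norm_transition_succ_sub_le`) — second order (base bond deviation
in the axial frame × accumulated relative deviation).  This is the ladder-level content of the block-wise choice
of gauges à la [Balaban1985RegularSpaces] Lemma 1 p. 79 in the RELATIVE setting: windows measured block by block
in the block's own relative gauge see only the LOCAL sums of §2, and the patching maps between neighbouring blocks
are rotations whose variation is second-order small; for Ad-covariant quantities and G-valued transition factors a
constant rotation is an isometry (`norm_conj_sub_one_eq`).  What is NOT here: the d-dimensional M-cube geometry,
overlaps of more than two blocks, and anything about Bałaban's averaged fields — record §4 (O2b). -/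

section Rebase

variable (h₀ h₁ : ℕ → Rˣ)

/-- The base transport along the block starting at rung `x₁`: `B 0 = 1`, `B (m+1) = B m · h₀(x₁+m)`. [folklore] -/
def baseProd (x₁ : ℕ) : ℕ → Rˣ
  | 0 => 1
  | m + 1 => baseProd x₁ m * h₀ (x₁ + m)

/-- [folklore] -/
@[simp] theorem baseProd_zero (x₁ : ℕ) : baseProd h₀ x₁ 0 = 1 := rfl

/-- [folklore] -/
theorem baseProd_succ (x₁ m : ℕ) : baseProd h₀ x₁ (m + 1) = baseProd h₀ x₁ m * h₀ (x₁ + m) := rfl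

/-- The TRANSITION FACTOR between the global relative gauge and the one re-based at rung `x₁`, at depth `m` into the
block: `c_m = B_m⁻¹ · u(x₁) · B_m`. [folklore] -/
def transition (x₁ m : ℕ) : Rˣ := (baseProd h₀ x₁ m)⁻¹ * relTransport h₀ h₁ x₁ * baseProd h₀ x₁ m

/-- [folklore] -/
theorem transition_zero (x₁ : ℕ) : transition h₀ h₁ x₁ 0 = relTransport h₀ h₁ x₁ := by
  simp [transition]

/-- [folklore] The transition factor is transported along the block by conjugation with the base bond:
`c_{m+1} = h₀(x₁+m)⁻¹ · c_m · h₀(x₁+m)`. -/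
theorem transition_succ (x₁ m : ℕ) :
    transition h₀ h₁ x₁ (m + 1) = (h₀ (x₁ + m))⁻¹ * transition h₀ h₁ x₁ m * h₀ (x₁ + m) := by
  simp only [transition, baseProd_succ, mul_inv_rev]; group

/-- REBASING IDENTITY: the global relative gauge at rung `x₁ + m` is the transition factor times the LOCAL relative
gauge of the block (the `relTransport` of the shifted ladders, based at the block entrance):
`u(x₁+m) = c_m · u_{[x₁]}(m)`. [folklore] -/
theorem relTransport_rebase (x₁ m : ℕ) :
    relTransport h₀ h₁ (x₁ + m)
      = transition h₀ h₁ x₁ m * relTransport (fun i => h₀ (x₁ + i)) (fun i => h₁ (x₁ + i)) m := by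
  induction m with
  | zero => simp [transition]
  | succ m ih =>
    rw [← add_assoc, relTransport_succ, ih, transition_succ, relTransport_succ]
    group

variable {h₀ h₁}

/-- The base transport along the block is unitary-like if the base bonds are. [folklore] -/
theorem unitaryLike_baseProd [NormOneClass R] (hh₀ : ∀ x, UnitaryLike (h₀ x)) (x₁ : ℕ) :
    ∀ m, UnitaryLike (baseProd h₀ x₁ m)
  | 0 => by simpa using (UnitaryLike.one : UnitaryLike (1 : Rˣ))
  | m + 1 => by
    rw [baseProd_succ]; exact UnitaryLike.mul (unitaryLike_baseProd hh₀ x₁ m) (hh₀ _)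

/-- CONSTANT DEVIATION: `‖c_m − 1‖ = ‖u(x₁) − 1‖` — conjugation by the unitary-like base transport is an isometry on
`· − 1`. [folklore] -/
theorem norm_transition_sub_one_eq [NormOneClass R] (hh₀ : ∀ x, UnitaryLike (h₀ x)) (x₁ m : ℕ) :
    ‖(transition h₀ h₁ x₁ m : R) - 1‖ = ‖(relTransport h₀ h₁ x₁ : R) - 1‖ := by
  have hB := (unitaryLike_baseProd hh₀ x₁ m).inv
  have e : (transition h₀ h₁ x₁ m : R)
      = ((baseProd h₀ x₁ m)⁻¹ : Rˣ) * (relTransport h₀ h₁ x₁ : R) * ↑((baseProd h₀ x₁ m)⁻¹)⁻¹ := by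
    simp only [transition, inv_inv, Units.val_mul]
  rw [e, norm_conj_sub_one_eq hB]

/-- [folklore] Commutator estimate: conjugating a near-identity element by a near-identity unitary-like unit moves it
by at most `2‖h − 1‖·‖c − 1‖` (second order). -/
theorem norm_unit_conj_sub_self_le {h : Rˣ} (hh : UnitaryLike h) (c : R) :
    ‖((h⁻¹ : Rˣ) : R) * c * h - c‖ ≤ 2 * ‖(h : R) - 1‖ * ‖c - 1‖ := by
  have e : ((h⁻¹ : Rˣ) : R) * c * h - c = ((h⁻¹ : Rˣ) : R) * ((c - 1) * ((h : R) - 1) - ((h : R) - 1) * (c - 1)) := by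
    have h1 : ((h⁻¹ : Rˣ) : R) * (h : R) = 1 := Units.inv_mul h
    calc ((h⁻¹ : Rˣ) : R) * c * h - c = ((h⁻¹ : Rˣ) : R) * c * h - ((h⁻¹ : Rˣ) : R) * (h : R) * c := by
            rw [h1, one_mul]
      _ = ((h⁻¹ : Rˣ) : R) * ((c - 1) * ((h : R) - 1) - ((h : R) - 1) * (c - 1)) := by noncomm_ring
  rw [e]
  calc ‖((h⁻¹ : Rˣ) : R) * ((c - 1) * ((h : R) - 1) - ((h : R) - 1) * (c - 1))‖
        ≤ ‖(c - 1) * ((h : R) - 1) - ((h : R) - 1) * (c - 1)‖ := norm_unit_mul_le hh.inv _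
    _ ≤ ‖(c - 1) * ((h : R) - 1)‖ + ‖((h : R) - 1) * (c - 1)‖ := norm_sub_le _ _
    _ ≤ ‖c - 1‖ * ‖(h : R) - 1‖ + ‖(h : R) - 1‖ * ‖c - 1‖ := add_le_add (norm_mul_le _ _) (norm_mul_le _ _)
    _ = 2 * ‖(h : R) - 1‖ * ‖c - 1‖ := by ring

/-- COVARIANTLY ALMOST CONSTANT: along the block the transition factor varies at second order,
`‖c_{m+1} − c_m‖ ≤ 2·‖h₀(x₁+m) − 1‖·‖u(x₁) − 1‖`. [folklore] -/
theorem norm_transition_succ_sub_le [NormOneClass R] (hh₀ : ∀ x, UnitaryLike (h₀ x)) (x₁ m : ℕ) :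
    ‖(transition h₀ h₁ x₁ (m + 1) : R) - transition h₀ h₁ x₁ m‖
      ≤ 2 * ‖(h₀ (x₁ + m) : R) - 1‖ * ‖(relTransport h₀ h₁ x₁ : R) - 1‖ := by
  rw [transition_succ, Units.val_mul, Units.val_mul, ← norm_transition_sub_one_eq (h₁ := h₁) hh₀ x₁ m]
  exact norm_unit_conj_sub_self_le (hh₀ _) _

/-- PATCHING BOUND: inside the block the global gauge differs from (transition factor at the entrance) × (local gauge)
only through the variation of the transition factor: with `‖h₀(x) − 1‖ ≤ b` (base bonds near `1` in the axial frame)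
and `‖u(x₁) − 1‖ ≤ T` (accumulated relative deviation at the entrance), `‖c_m − c_0‖ ≤ m·(2·b·T)`. [folklore] -/
theorem norm_transition_sub_transition_zero_le [NormOneClass R] {x₁ : ℕ} {b T : ℝ} (hh₀ : ∀ x, UnitaryLike (h₀ x))
    (hb : ∀ x, ‖(h₀ x : R) - 1‖ ≤ b) (hT : ‖(relTransport h₀ h₁ x₁ : R) - 1‖ ≤ T) :
    ∀ m, ‖(transition h₀ h₁ x₁ m : R) - transition h₀ h₁ x₁ 0‖ ≤ m * (2 * b * T)
  | 0 => by simp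
  | m + 1 => by
    have ih := norm_transition_sub_transition_zero_le hh₀ hb hT m
    have hstep : ‖(transition h₀ h₁ x₁ (m + 1) : R) - transition h₀ h₁ x₁ m‖ ≤ 2 * b * T :=
      (norm_transition_succ_sub_le hh₀ x₁ m).trans
        (mul_le_mul (mul_le_mul_of_nonneg_left (hb _) (by norm_num)) hT (norm_nonneg _)
          (mul_nonneg (by norm_num) ((norm_nonneg _).trans (hb (x₁ + m)))))
    calc ‖(transition h₀ h₁ x₁ (m + 1) : R) - transition h₀ h₁ x₁ 0‖
          = ‖((transition h₀ h₁ x₁ (m + 1) : R) - transition h₀ h₁ x₁ m)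
              + ((transition h₀ h₁ x₁ m : R) - transition h₀ h₁ x₁ 0)‖ := by rw [sub_add_sub_cancel]
      _ ≤ 2 * b * T + m * (2 * b * T) := (norm_add_le _ _).trans (add_le_add hstep ih)
      _ = (m + 1 : ℕ) * (2 * b * T) := by push_cast; ring

end Rebase

/-! ## §9  Second differences along the ladder (local) — the first piece of the Hölder part of (O2a)  [folklore]

The ladder identity `W(m+1) = F_m(W(m))` with the LINEAR map `F_m(X) = hb(m)⁻¹·(P₁(m)·X·P₀(m)⁻¹)·hb(m)`
(`ladderMap`) gives for the second difference along the ladder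
`Δ²W(m) = [F_{m+1} − F_m](W(m+1)) + [F_m − id](ΔW(m))`: the first bracket is controlled by the x-GRADIENTS of the
data (of the relative deviation `E = P₁ − P₀`, of the base plaquette `P₀`, of the base bond `hb`) times zeroth-order
quantities, the second by the first difference `ΔW(m)` (local, `norm_defect_succ_sub_defect_le`) times the smallness
of `P₁ − 1`, `P₀ − 1`, `hb − 1` — `norm_defect_second_diff_le`.  So along a tooth BOTH the first and the second
differences of the transverse defect are local expressions in the deviation, its gradient and base data; the Hölder
quotient of [Balaban1987RG1] (3.31) along the tooth then follows by the elementary interpolation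
`[f]_β ≤ 2^{1−β}‖Δf‖_∞^{1−β}‖Δ²f‖_∞^{β}`-type bound (not formalised here).  ACROSS teeth (xy, yy second differences)
the same one-level-up bookkeeping applies to the covariant recursion of §6 — census statement, kernel deferred
(record §4 (O2a)). -/

section SecondDiff

/-- The linear ladder map `F(X) = hb⁻¹·(P₁·X·P₀⁻¹)·hb` of one square (`defect_succ`: `W(m+1) = F_m(W(m))`). [folklore] -/
def ladderMap (hb P₁ P₀ : Rˣ) (X : R) : R := ((hb⁻¹ : Rˣ) : R) * ((P₁ : R) * X * ↑P₀⁻¹) * hb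

/-- [folklore] Linearity of the ladder map. -/
theorem ladderMap_sub (hb P₁ P₀ : Rˣ) (X Y : R) :
    ladderMap hb P₁ P₀ X - ladderMap hb P₁ P₀ Y = ladderMap hb P₁ P₀ (X - Y) := by
  simp only [ladderMap]; noncomm_ring

/-- [folklore] The ladder identity in the ring: `W(m+1) = F_m(W(m))`. -/
theorem defect_succ_eq_ladderMap (hb ht v₀ v₁ : ℕ → Rˣ) (m : ℕ) :
    (defect v₀ v₁ (m + 1) : R) = ladderMap (hb m) (plaq hb ht v₁ m) (plaq hb ht v₀ m) (defect v₀ v₁ m) := by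
  rw [defect_succ hb ht v₀ v₁ m]; simp only [ladderMap, Units.val_mul]

/-- [folklore] Conjugation by a unitary-like unit moves a general element `Y` by at most `2‖h − 1‖·‖Y‖`. -/
theorem norm_unit_conj_sub_self_le' {h : Rˣ} (hh : UnitaryLike h) (Y : R) :
    ‖((h⁻¹ : Rˣ) : R) * Y * h - Y‖ ≤ 2 * ‖(h : R) - 1‖ * ‖Y‖ := by
  have e : ((h⁻¹ : Rˣ) : R) * Y * h - Y = ((h⁻¹ : Rˣ) : R) * (Y * ((h : R) - 1) - ((h : R) - 1) * Y) := by
    have h1 : ((h⁻¹ : Rˣ) : R) * (h : R) = 1 := Units.inv_mul h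
    calc ((h⁻¹ : Rˣ) : R) * Y * h - Y = ((h⁻¹ : Rˣ) : R) * Y * h - ((h⁻¹ : Rˣ) : R) * (h : R) * Y := by
            rw [h1, one_mul]
      _ = _ := by noncomm_ring
  rw [e]
  calc ‖((h⁻¹ : Rˣ) : R) * (Y * ((h : R) - 1) - ((h : R) - 1) * Y)‖
        ≤ ‖Y * ((h : R) - 1) - ((h : R) - 1) * Y‖ := norm_unit_mul_le hh.inv _
    _ ≤ ‖Y * ((h : R) - 1)‖ + ‖((h : R) - 1) * Y‖ := norm_sub_le _ _
    _ ≤ ‖Y‖ * ‖(h : R) - 1‖ + ‖(h : R) - 1‖ * ‖Y‖ := add_le_add (norm_mul_le _ _) (norm_mul_le _ _)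
    _ = 2 * ‖(h : R) - 1‖ * ‖Y‖ := by ring

/-- `[F − id]` ON A SMALL ELEMENT: `‖F(X) − X‖ ≤ ‖X‖·(‖P₁ − 1‖ + ‖P₀ − 1‖ + 2‖hb − 1‖)` — second order when `X` is a
first difference. [folklore] -/
theorem norm_ladderMap_sub_self_le {hb P₁ P₀ : Rˣ} (hhb : UnitaryLike hb) (hP₀ : UnitaryLike P₀) (X : R) :
    ‖ladderMap hb P₁ P₀ X - X‖ ≤ ‖X‖ * (‖(P₁ : R) - 1‖ + ‖(P₀ : R) - 1‖ + 2 * ‖(hb : R) - 1‖) := by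
  set Y : R := (P₁ : R) * X * ↑P₀⁻¹ with hY
  have hYX : ‖Y - X‖ ≤ ‖X‖ * (‖(P₁ : R) - 1‖ + ‖(P₀ : R) - 1‖) := by
    have e : Y - X = ((P₁ : R) - 1) * X * ↑P₀⁻¹ + X * (((P₀⁻¹ : Rˣ) : R) - 1) := by
      rw [hY]; noncomm_ring
    rw [e]
    calc ‖((P₁ : R) - 1) * X * ↑P₀⁻¹ + X * (((P₀⁻¹ : Rˣ) : R) - 1)‖
          ≤ ‖((P₁ : R) - 1) * X * ↑P₀⁻¹‖ + ‖X * (((P₀⁻¹ : Rˣ) : R) - 1)‖ := norm_add_le _ _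
      _ ≤ ‖(P₁ : R) - 1‖ * ‖X‖ + ‖X‖ * ‖(P₀ : R) - 1‖ := by
            refine add_le_add ((norm_mul_unit_le hP₀.inv _).trans (norm_mul_le _ _)) ?_
            exact (norm_mul_le _ _).trans (mul_le_mul_of_nonneg_left (norm_inv_sub_one_le hP₀) (norm_nonneg _))
      _ = ‖X‖ * (‖(P₁ : R) - 1‖ + ‖(P₀ : R) - 1‖) := by ring
  have hconj : ‖((hb⁻¹ : Rˣ) : R) * Y * hb - ((hb⁻¹ : Rˣ) : R) * X * hb‖ ≤ ‖Y - X‖ := by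
    have e : ((hb⁻¹ : Rˣ) : R) * Y * hb - ((hb⁻¹ : Rˣ) : R) * X * hb = ((hb⁻¹ : Rˣ) : R) * (Y - X) * hb := by
      noncomm_ring
    rw [e]; exact (norm_mul_unit_le hhb _).trans (norm_unit_mul_le hhb.inv _)
  have hcomm := norm_unit_conj_sub_self_le' hhb X
  calc ‖ladderMap hb P₁ P₀ X - X‖
        = ‖(((hb⁻¹ : Rˣ) : R) * Y * hb - ((hb⁻¹ : Rˣ) : R) * X * hb) + (((hb⁻¹ : Rˣ) : R) * X * hb - X)‖ := by
          simp only [ladderMap, ← hY, sub_add_sub_cancel]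
    _ ≤ ‖Y - X‖ + 2 * ‖(hb : R) - 1‖ * ‖X‖ := (norm_add_le _ _).trans (add_le_add hconj hcomm)
    _ ≤ ‖X‖ * (‖(P₁ : R) - 1‖ + ‖(P₀ : R) - 1‖) + 2 * ‖(hb : R) - 1‖ * ‖X‖ := by linarith
    _ = ‖X‖ * (‖(P₁ : R) - 1‖ + ‖(P₀ : R) - 1‖ + 2 * ‖(hb : R) - 1‖) := by ring

/-- [folklore] Two conjugations of the same element compared: `‖a⁻¹·Y·a − b⁻¹·Y·b‖ ≤ 2‖a − b‖·‖Y‖`. -/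
theorem norm_conj_sub_conj_le {a b : Rˣ} (ha : UnitaryLike a) (hb : UnitaryLike b) (Y : R) :
    ‖((a⁻¹ : Rˣ) : R) * Y * a - ((b⁻¹ : Rˣ) : R) * Y * b‖ ≤ 2 * ‖(a : R) - b‖ * ‖Y‖ := by
  have e : ((a⁻¹ : Rˣ) : R) * Y * a - ((b⁻¹ : Rˣ) : R) * Y * b
      = (((a⁻¹ : Rˣ) : R) - ↑b⁻¹) * Y * a + ((b⁻¹ : Rˣ) : R) * Y * ((a : R) - b) := by noncomm_ring
  rw [e]
  calc ‖(((a⁻¹ : Rˣ) : R) - ↑b⁻¹) * Y * a + ((b⁻¹ : Rˣ) : R) * Y * ((a : R) - b)‖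
        ≤ ‖(((a⁻¹ : Rˣ) : R) - ↑b⁻¹) * Y * a‖ + ‖((b⁻¹ : Rˣ) : R) * Y * ((a : R) - b)‖ := norm_add_le _ _
    _ ≤ ‖(a : R) - b‖ * ‖Y‖ + ‖Y‖ * ‖(a : R) - b‖ := by
          refine add_le_add ?_ ?_
          · exact (norm_mul_unit_le ha _).trans
              ((norm_mul_le _ _).trans (mul_le_mul_of_nonneg_right (norm_inv_sub_inv_le ha hb) (norm_nonneg _)))
          · rw [mul_assoc]
            exact (norm_unit_mul_le hb.inv _).trans (norm_mul_le _ _)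
    _ = 2 * ‖(a : R) - b‖ * ‖Y‖ := by ring

/-- `[F′ − F]` ON A NEAR-IDENTITY ELEMENT: comparing the ladder maps of two consecutive squares on the same `W`,
`‖F′(W) − F(W)‖ ≤ 2‖hb′ − hb‖(‖W − 1‖ + ‖P₁′ − P₀′‖) + ‖(P₁′ − P₀′) − (P₁ − P₀)‖ + ‖P₀′ − P₀‖(2‖W − 1‖ + ‖P₁ − P₀‖)`
— first order in the GRADIENTS of the data, times zeroth-order quantities. [folklore] -/
theorem norm_ladderMap_sub_ladderMap_le {hb hb' P₁ P₀ P₁' P₀' W : Rˣ} (hhb : UnitaryLike hb) (hhb' : UnitaryLike hb')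
    (hP₁' : UnitaryLike P₁') (hP₀ : UnitaryLike P₀) (hP₀' : UnitaryLike P₀') (hW : UnitaryLike W) :
    ‖ladderMap hb' P₁' P₀' W - ladderMap hb P₁ P₀ W‖ ≤
      2 * ‖(hb' : R) - hb‖ * (‖(W : R) - 1‖ + ‖(P₁' : R) - P₀'‖) + ‖((P₁' : R) - P₀') - ((P₁ : R) - P₀)‖ +
        ‖(P₀' : R) - P₀‖ * (2 * ‖(W : R) - 1‖ + ‖(P₁ : R) - P₀‖) := by
  set Z' : R := (P₁' : R) * W * ↑P₀'⁻¹ with hZ'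
  set Z : R := (P₁ : R) * W * ↑P₀⁻¹ with hZ
  -- split: change of conjugator on Z', then change of the triple under a fixed conjugation
  have h1 : ‖((hb'⁻¹ : Rˣ) : R) * Z' * hb' - ((hb⁻¹ : Rˣ) : R) * Z' * hb‖
      ≤ 2 * ‖(hb' : R) - hb‖ * (‖(W : R) - 1‖ + ‖(P₁' : R) - P₀'‖) := by
    have e : ((hb'⁻¹ : Rˣ) : R) * Z' * hb' - ((hb⁻¹ : Rˣ) : R) * Z' * hb
        = ((hb'⁻¹ : Rˣ) : R) * (Z' - 1) * hb' - ((hb⁻¹ : Rˣ) : R) * (Z' - 1) * hb := by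
      simp only [mul_sub, sub_mul, mul_one, Units.inv_mul]; abel
    rw [e]
    exact (norm_conj_sub_conj_le hhb' hhb _).trans
      (mul_le_mul_of_nonneg_left (by simpa [hZ'] using norm_triple_sub_one_le hP₁' hP₀' (W : R))
        (mul_nonneg (by norm_num) (norm_nonneg _)))
  have h2 : ‖((hb⁻¹ : Rˣ) : R) * Z' * hb - ((hb⁻¹ : Rˣ) : R) * Z * hb‖ ≤ ‖Z' - Z‖ := by
    have e : ((hb⁻¹ : Rˣ) : R) * Z' * hb - ((hb⁻¹ : Rˣ) : R) * Z * hb = ((hb⁻¹ : Rˣ) : R) * (Z' - Z) * hb := by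
      noncomm_ring
    rw [e]; exact (norm_mul_unit_le hhb _).trans (norm_unit_mul_le hhb.inv _)
  have h3 : ‖Z' - Z‖ ≤ ‖((P₁' : R) - P₀') - ((P₁ : R) - P₀)‖ +
      ‖(P₀' : R) - P₀‖ * (2 * ‖(W : R) - 1‖ + ‖(P₁ : R) - P₀‖) := by
    have h := norm_triple_sub_triple_le (P₁ := P₁) (P₁' := P₁') hP₀ hP₀' hW hW
    simp only [sub_self, norm_zero, zero_mul, zero_add] at h
    simpa [hZ', hZ] using h
  calc ‖ladderMap hb' P₁' P₀' W - ladderMap hb P₁ P₀ W‖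
        = ‖(((hb'⁻¹ : Rˣ) : R) * Z' * hb' - ((hb⁻¹ : Rˣ) : R) * Z' * hb)
            + (((hb⁻¹ : Rˣ) : R) * Z' * hb - ((hb⁻¹ : Rˣ) : R) * Z * hb)‖ := by
          simp only [ladderMap, ← hZ', ← hZ, sub_add_sub_cancel]
    _ ≤ _ := norm_add_le _ _
    _ ≤ 2 * ‖(hb' : R) - hb‖ * (‖(W : R) - 1‖ + ‖(P₁' : R) - P₀'‖) + (‖((P₁' : R) - P₀') - ((P₁ : R) - P₀)‖ +
          ‖(P₀' : R) - P₀‖ * (2 * ‖(W : R) - 1‖ + ‖(P₁ : R) - P₀‖)) := add_le_add h1 (h2.trans h3)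
    _ = _ := by ring

/-- SECOND DIFFERENCE ALONG THE LADDER (local): with `W = defect v₀ v₁`, `P_c = plaq hb ht v_c`, `E = P₁ − P₀`,
`‖(W(m+2) − W(m+1)) − (W(m+1) − W(m))‖ ≤ [gradient terms at (m, m+1)] + ‖W(m+1) − W(m)‖·[smallness of P₁(m), P₀(m),
hb(m)]`.  Every quantity on the right is a deviation, a gradient of a deviation, or base data of ONE or TWO
consecutive squares. [folklore] -/
theorem norm_defect_second_diff_le {hb ht v₀ v₁ : ℕ → Rˣ} (hhb : ∀ m, UnitaryLike (hb m))
    (hht : ∀ m, UnitaryLike (ht m)) (hv₀ : ∀ m, UnitaryLike (v₀ m)) (hv₁ : ∀ m, UnitaryLike (v₁ m)) (m : ℕ) :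
    ‖((defect v₀ v₁ (m + 2) : R) - defect v₀ v₁ (m + 1)) - ((defect v₀ v₁ (m + 1) : R) - defect v₀ v₁ m)‖ ≤
      2 * ‖(hb (m + 1) : R) - hb m‖ *
          (‖(defect v₀ v₁ (m + 1) : R) - 1‖ + ‖(plaq hb ht v₁ (m + 1) : R) - plaq hb ht v₀ (m + 1)‖) +
        ‖((plaq hb ht v₁ (m + 1) : R) - plaq hb ht v₀ (m + 1)) - ((plaq hb ht v₁ m : R) - plaq hb ht v₀ m)‖ +
        ‖(plaq hb ht v₀ (m + 1) : R) - plaq hb ht v₀ m‖ *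
          (2 * ‖(defect v₀ v₁ (m + 1) : R) - 1‖ + ‖(plaq hb ht v₁ m : R) - plaq hb ht v₀ m‖) +
        ‖(defect v₀ v₁ (m + 1) : R) - defect v₀ v₁ m‖ *
          (‖(plaq hb ht v₁ m : R) - 1‖ + ‖(plaq hb ht v₀ m : R) - 1‖ + 2 * ‖(hb m : R) - 1‖) := by
  have hP : ∀ (v : ℕ → Rˣ), (∀ m, UnitaryLike (v m)) → ∀ m, UnitaryLike (plaq hb ht v m) := fun v hv m =>
    UnitaryLike.mul (UnitaryLike.mul (UnitaryLike.mul (hhb m) (hv _)) (hht m).inv) (hv m).inv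
  have hW : ∀ m, UnitaryLike (defect v₀ v₁ m) := fun m => UnitaryLike.mul (hv₁ m) (hv₀ m).inv
  -- W(m+2) = F_{m+1}(W(m+1)), W(m+1) = F_m(W(m))
  have e2 := defect_succ_eq_ladderMap hb ht v₀ v₁ (m + 1)
  have e1 := defect_succ_eq_ladderMap hb ht v₀ v₁ m
  -- the split Δ²W = [F' − F](W(m+1)) + [F − id](ΔW)
  have split : ((defect v₀ v₁ (m + 2) : R) - defect v₀ v₁ (m + 1)) - ((defect v₀ v₁ (m + 1) : R) - defect v₀ v₁ m)
      = (ladderMap (hb (m + 1)) (plaq hb ht v₁ (m + 1)) (plaq hb ht v₀ (m + 1)) (defect v₀ v₁ (m + 1))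
          - ladderMap (hb m) (plaq hb ht v₁ m) (plaq hb ht v₀ m) (defect v₀ v₁ (m + 1)))
        + (ladderMap (hb m) (plaq hb ht v₁ m) (plaq hb ht v₀ m) ((defect v₀ v₁ (m + 1) : R) - defect v₀ v₁ m)
          - ((defect v₀ v₁ (m + 1) : R) - defect v₀ v₁ m)) := by
    rw [← ladderMap_sub, ← e1, show m + 2 = m + 1 + 1 from rfl, e2]; abel
  rw [split]
  refine (norm_add_le _ _).trans (add_le_add ?_ ?_)
  · exact norm_ladderMap_sub_ladderMap_le (hhb m) (hhb (m + 1)) (hP v₁ hv₁ (m + 1)) (hP v₀ hv₀ m)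
      (hP v₀ hv₀ (m + 1)) (hW (m + 1))
  · exact norm_ladderMap_sub_self_le (hhb m) (hP v₀ hv₀ m) _

end SecondDiff

end Literature.MathematicalPhysics.QuantumFieldTheory.Balaban1983to89.T4RelativeLadder
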